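import Literature.NumberTheory.EllipticCurves.EichlerShimuraPeriods
import Literature.NumberTheory.EllipticCurves.ModularFormsRamanujan
import Literature.NumberTheory.EllipticCurves.ModularPolynomial
import Literature.NumberTheory.Transcendental.KZCalculus
import Mathlib.Analysis.Real.Pi.Bounds
import Mathlib.Analysis.Complex.ExponentialBounds
import HarnessLib

/-!
# Modular symbols as Kontsevich–Zagier integral representations

Topic `NumberTheory/EllipticCurves` (definition request `ModularSymbolRep` of route
`KontsevichZagierPeriods/HeckeMultiplicityOne`, next to `ModularSymbols`, `EichlerShimuraPeriods`,
`ModularCurveKleinJ`).  For a weight-`2` cusp form `f` on `Γ₀(N)` and `g = (a b; c d) ∈ SL₂(ℤ)` the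
**unimodular (Manin) symbol** `⟨g⟩_f = 2πi ∫_{g0}^{g∞} f(z) dz` (Cremona's `(g) = {g(0), g(∞)}`,
`⟨(g), f⟩ = ∫ 2πi f dz`, §2.1 (2.1.1), (2.1.6)) is a period; this file writes its real and imaginary
parts as elements of the tree's Kontsevich–Zagier calculus
(`Literature.NumberTheory.Transcendental.KZ.IntegralRep 1`, `KZ.FormalRep`, `KZ.relations` of
`Transcendental/KZCalculus`): absolutely convergent integrals of functions of ONE real variable over
the `ℚ`-semialgebraic domain `(1728, ∞)`, in the **algebraic coordinate `u = j`** of the modular curve.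

## The construction

* The arc `g·(i t)`, `t > 0`, is split at `g·i` into the two half-arcs `t > 1` and `t < 1`; since
  `g·(i/t) = gS·(it)`, `⟨g⟩_f = h(f ∣ g) − h(f ∣ gS)` with the **half-arc integral**
  `h(φ) = halfArcSymbol φ = 2πi ∫_i^{i∞} φ(z) dz = 2πi · eichlerPrimitive φ i`
  (`unimodularSymbol`, `unimodularSymbol_eq_periodFn`: `⟨g⟩_f = 2πi (c_f(g) − c_f(gS))` in terms of
  the period cocycle `periodFn 0` of `EichlerShimuraPeriods`).
* On the half-axis `{it | t > 1}` Klein's `j` is REAL (`kleinJ_axisPt_im`: integral `q`-expansion,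
  `q = e^{-2πt}`), injective (`injOn_axisJ`: the open fundamental domain, Mathlib
  `ModularGroup.eq_smul_self_of_mem_fdo_mem_fdo`), strictly increasing from `j(i) = 1728` to `+∞`
  (`strictMonoOn_axisJ`, `axisJ_gt`: `j(it) = e^{2πt} + 744 + O(e^{-2πt})` from
  `KleinJCuspExpansion`, `image_axisJ_Ioi : j(i·(1,∞)) = (1728, ∞)`), with positive derivative
  (`axisJDeriv_pos`; `j'(it) ≠ 0` as `it` is not elliptic, `deriv_kleinJ_ne_zero_iff` of
  `ModularFormsRamanujan`).  So `u = axisJ t = j(it)` is a coordinate on the half-arc with inverse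
  `t₊ = axisParam` (`axisParam_spec`, `axisParam_axisJ`).
* In this coordinate `2πi φ(z) dz = (2πi φ / j')(z) dj`, and by Ramanujan's `j' = -2πi E₄²E₆/Δ`
  (`deriv_kleinJ_comp_ofComplex`) the quotient is DERIVATIVE-FREE:
  `djQuot φ = 2πi φ/j' = -φΔ/(E₄²E₆)`, a quotient of weight-`14` forms — for `φ = f` it is the
  rational function `ω_f/dj ∈ ℚ(X₀(N)) = ℚ(j, j_N)` when `f` has rational coefficients.  The
  **canonical integrand** is `arcIntegrand φ u = djQuot φ (i t₊(u))`, `u > 1728`, and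
  **`∫_{u > 1728} arcIntegrand φ u du = halfArcSymbol φ` for every `φ : ℍ → ℂ`**
  (`integral_arcIntegrand`, proved: Mathlib's one-variable Jacobian formula
  `integral_image_eq_integral_abs_deriv_smul`; both sides are junk `0` together when divergent).
* `HalfArcAdmissible φ` (a `Prop` structure) records what the calculus demands of the integrand:
  `ℚ`-semialgebraicity of `re` and `im` of `arcIntegrand φ` on `arcDomain = {u | 1728 < u} ⊆ ℝ¹` and
  absolute integrability; the latter holds for every cusp function
  (`IsCuspFunction.integrableOn_arcIntegrand`, `HalfArcAdmissible.of_isCuspFunction`), in particular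
  for `f ∣ g`, `g ∈ SL₂(ℤ)` (`isCuspFunction_slash`).  Then `halfArcRepRe φ h`, `halfArcRepIm φ h :
  KZ.IntegralRep 1` have values `re`/`im (halfArcSymbol φ)` (`halfArcRepRe_value`,
  `halfArcRepIm_value`).
* **`ModularSymbolRep f g : Prop`** — *the modular symbol `⟨g⟩_f` admits its canonical KZ
  representation* — is the conjunction of admissibility of the two half-arcs `f ∣ g`, `f ∣ gS`; its
  inhabitants `ρ` give the classes `ρ.classRe`, `ρ.classIm : KZ.FormalRep`
  (`[h(f∣g)] − [h(f∣gS)]`) with **`KZ.eval ρ.classRe = re ⟨g⟩_f`, `KZ.eval ρ.classIm = im ⟨g⟩_f`**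
  (`ModularSymbolRep.eval_classRe`, `eval_classIm`).

## What is proved about the representations

* **Two-term relation** `(g) + (gS) = 0` (Cremona (2.1.4)) holds IDENTICALLY in `FormalRep`:
  `ρ.classRe + ρ'.classRe = 0` (`classRe_add_classRe_mul_S`; `f ∣ gS² = f ∣ (-g) = f ∣ g`).
* **Hecke**: the pointwise trace identity `a · arcIntegrand (f∣g) = Σᵢ arcIntegrand (f∣βᵢg)` for
  `T_p f = a f` (`arcIntegrand_heckeT`, from `coe_heckeT_gamma0`, Diamond–Shurman Prop. 5.2.1; the
  modular-symbol form is Cremona (2.8.7)–(2.8.8)), and the `p + 1` **Hecke branches**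
  `heckeBranch p i u = j(βᵢ · i t₊(u))` on the `u`-line, roots of the modular equation
  `Φ_p(w, u) = 0` (`modularPolynomial_heckeBranch`, from `ModularPolynomial`; the branch `∞` is real,
  `heckeBranch_none_im`; the branches `k`, `p - k` are complex conjugate).
* **The real structure** `z ↦ z* = -z̄`, `g ↦ g̃ = JgJ`, `J = diag(-1, 1)` (Cremona §2.1): for `f`
  with real Fourier coefficients `(f ∣ g̃)(it) = conj ((f ∣ g)(it))` (`slash_reflect_axisPt`), so in the
  coordinate `u` the involution is `(u, w) ↦ (u, w̄)`: `arcIntegrand (f ∣ g̃) = conj ∘ arcIntegrand (f ∣ g)`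
  on the domain (`arcIntegrand_reflect`); admissibility transfers (`ModularSymbolRep.reflect`) and
  **`[re ⟨g̃⟩] ≡ [re ⟨g⟩]`, `[im ⟨g̃⟩] + [im ⟨g⟩] ≡ 0` modulo `KZ.relations`** by integrand
  additivity alone (`classRe_reflect_sub_mem_relations`, `classIm_reflect_add_mem_relations`, via the
  general `equivalent_of_eqOn`, `of_add_of_mem_relations_of_eqOn_neg`).

## The one named fact (existence for rational cusp forms)

Everything above is proved.  The EXISTENCE statement — `ℚ`-semialgebraicity of
`u ↦ re/im (ω_f/dj)(g · i t₊(u))` on `(1728, ∞)` for `f` with rational Fourier coefficients — is the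
named fact `isSemialgebraicFunOn_arcIntegrand_slash`, the conjunction of Shimura's description of
the field `𝔉_N` of arithmetic modular functions (Thm. 6.6, Prop. 6.9: `(f ∣ g)Δ/(E₄²E₆) ∈ 𝔉_N` is
algebraic over `ℚ(j)`) and cylindrical decomposition over `ℚ` (Basu–Pollack–Roy Thm. 5.6,
Thm. 2.76–2.77: a continuous branch of a `ℚ`-algebraic curve with finite fibres over an interval is
`ℚ`-semialgebraic); the tree has neither `𝔉_N` nor cylindrical decomposition (Tarski–Seidenberg
itself is the named fact `Literature.ModelTheory.ExponentialFields.tarski_seidenberg_real`).  From it,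
`ModularSymbolRep.of_hasRatCoeffs : ModularSymbolRep f g` for every `g` (integrability being
proved), so that `re ⟨g⟩_f`, `im ⟨g⟩_f` are values of the canonical representations
(`eval_classRe_of_hasRatCoeffs`).  Route statements may either quantify over
`ρ : ModularSymbolRep f g` (fact-free) or instantiate with `of_hasRatCoeffs`.

## References

* M. Kontsevich, D. Zagier, *Periods*, in: Mathematics Unlimited — 2001 and Beyond, Springer 2001,
  §1.1–1.2 (the calculus), §2.3 Facts 1–2 and §3.4 (modular forms reparametrised by a modular
  function; `L(f, m) ∈ P̂`). [KontsevichZagier2001]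
* J. E. Cremona, *Algorithms for modular elliptic curves*, 2nd ed., CUP 1997, §2.1 ((2.1.1),
  (2.1.3)–(2.1.4), (2.1.6); the involution `z ↦ -z̄`, `γ̃ = JγJ`), §2.2 (M-symbols), §2.8
  ((2.8.7)–(2.8.8), conjugation of symbols), §2.10. [CremonaAlgorithms1997]
* Ju. I. Manin, *Parabolic points and zeta functions of modular curves*, Izv. Akad. Nauk SSSR 36
  (1972), §1.2–1.6, Thm. 1.9. [Manin1972]
* F. Diamond, J. Shurman, *A First Course in Modular Forms*, GTM 228, Springer 2005, Prop. 5.2.1,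
  §7.5 Prop. 7.5.1. [DiamondShurman2005]
* G. Shimura, *Introduction to the arithmetic theory of automorphic functions*, Iwanami Shoten /
  Princeton UP 1971, §6.1–6.2: Thm. 6.6, Prop. 6.9; §8.2 (8.2.20). [Shimura1971]
* S. Basu, R. Pollack, M.-F. Roy, *Algorithms in Real Algebraic Geometry*, 2nd ed., Springer 2006,
  Thm. 2.76–2.77 (projection and quantifier elimination over the ring of coefficients), Def. 5.1,
  Prop. 5.3, Thm. 5.6 (cylindrical decomposition). [BasuPollackRoy2006]
* D. A. Cox, *Primes of the form x² + ny²*, 2nd ed., Wiley 2013, §11.B (11.14)–(11.15). [Cox2013]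

## Design notes

* Mathlib (v4.32 pin; searched `modularSymbol`, `Manin`, `kleinJ`, `IsPeriod`, `semialgebraic`) has
  cusp forms, the slash action `f ∣[k] g` (with `|det|^{k-1}`), `UpperHalfPlane.ofComplex`, the
  fundamental domain `ModularGroup.fd/fdo`, `E₄`, `E₆`, `ModularForm.discriminant`, the Bochner
  integral and the one-dimensional change of variables; it has no modular symbols, no `j` on `ℍ` and
  no periods — those are the tree's (`ModularSymbols*`, `EichlerShimuraPeriods`, `ModularCurveKleinJ`,
  `ModularFormsRamanujan`, `KleinJ*QExpansion`, `ModularPolynomial`, `HeckeOperators*`, `KZCalculus`),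
  all reused, nothing redefined.
* Why half-arcs: both halves of `g·(iℝ_{>0})` have the same `j`-image `(1728, ∞)`, so a single
  one-dimensional domain cannot carry the whole arc injectively; splitting at `g·i` makes the
  two-term relation an identity and keeps every representation on the common domain `arcDomain`, on
  which Hecke translates, reflections and reversals are compared pointwise.
* Why `u = j` (level one) rather than a coordinate of `X₀(N)`: `j` is real on all the arcs at once
  (`j(g·it) = j(it)`), is in the tree with its `q`-expansion, derivative and orbit criterion, and the
  level enters only through the integrand `ω_f/dj`, a rational function of `(j, j_N)`.
* Junk values: `axisPt t` for `t ≤ 0` and `axisParam u` for `u ≤ 1728` are Mathlib/`invFunOn` junk;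
  every statement about them carries the hypothesis `0 < t`, `1 < t` or `1728 < u`, and the KZ
  representations only see `arcDomain`.
* `ModularSymbolRep` is a `Prop` (admissibility of a CANONICAL representation), not data: there is
  no choice in the representation, so nothing to carry; existence is the separate named fact above,
  never smuggled into the interface.
-/

noncomputable section

open scoped MatrixGroups ModularForm Topology Manifold
open CongruenceSubgroup Complex MeasureTheory Set Filter Function
open UpperHalfPlane hiding I
open ModularForm EisensteinSeries PowerSeries
open Literature.NumberTheory.Transcendental (IsSemialgebraicFunOn IsSemialgebraicMapOn)

namespace Literature.NumberTheory.EllipticCurves.ModularForms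

/-! ### The imaginary half-axis and its algebraic coordinate `u = j(it)` -/

/-- The point `it` of the imaginary axis, `t > 0` — the geodesic from the cusp `0` to the cusp `∞`,
whose `SL₂(ℤ)`-translates `g·(it)` carry the unimodular symbols `{g(0), g(∞)}` (Cremona §2.1); for
`t ≤ 0` this is Mathlib's junk value of `UpperHalfPlane.ofComplex`. [cite: CremonaAlgorithms1997, §2.1 (2.1.6)] -/
def axisPt (t : ℝ) : ℍ := ofComplex ((t : ℂ) * I)

/-- **The algebraic coordinate `u = j(it)` on the imaginary axis** (real part of Klein's
`j = E₄³/Δ`; `j(it)` is real, `kleinJ_axisPt_im`): the level-one modular function that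
reparametrises the arc algebraically, as in Kontsevich–Zagier's treatment of integrals of modular
forms (§2.3 Fact 1, §3.4: "use it to reparametrize our modular curve"). [cite: KontsevichZagier2001, §3.4] -/
def axisJ (t : ℝ) : ℝ := (kleinJ (axisPt t)).re

/-- The inverse branch `t₊(u)` of the coordinate: the unique `t > 1` with `j(it) = u`, for
`u > 1728` (`axisParam_spec`, `axisParam_axisJ`; `Function.invFunOn` junk for `u ≤ 1728`). [folklore] -/
def axisParam (u : ℝ) : ℝ := Function.invFunOn axisJ (Ioi 1) u

/-- For `t > 0`, `axisPt t = ⟨it, _⟩`. [folklore] -/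
theorem axisPt_of_pos {t : ℝ} (ht : 0 < t) :
    axisPt t = ⟨(t : ℂ) * I, by simpa using ht⟩ :=
  ofComplex_apply_of_im_pos _

/-- For `t > 0`, `(axisPt t : ℂ) = it`. [folklore] -/
@[simp] theorem coe_axisPt {t : ℝ} (ht : 0 < t) : ((axisPt t : ℍ) : ℂ) = (t : ℂ) * I := by
  rw [axisPt_of_pos ht]

/-- For `t > 0`, `im (axisPt t) = t`. [folklore] -/
theorem im_axisPt {t : ℝ} (ht : 0 < t) : (axisPt t).im = t := by
  rw [← UpperHalfPlane.coe_im, coe_axisPt ht]; simp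

/-- For `t > 0`, `re (axisPt t) = 0`. [folklore] -/
theorem re_axisPt {t : ℝ} (ht : 0 < t) : (axisPt t).re = 0 := by
  rw [← UpperHalfPlane.coe_re, coe_axisPt ht]; simp

/-- `axisPt 1 = i`. [folklore] -/
@[simp] theorem axisPt_one : axisPt 1 = UpperHalfPlane.I := by
  apply UpperHalfPlane.ext; rw [coe_axisPt one_pos]; simp

/-- On the imaginary axis the nome `q = e^{2πiτ}` is the real number `e^{-2πt}`. [folklore] -/
theorem qParam_axisPt {t : ℝ} (ht : 0 < t) :
    Function.Periodic.qParam 1 (axisPt t : ℂ) = (Real.exp (-(2 * Real.pi * t)) : ℂ) := by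
  rw [Function.Periodic.qParam, coe_axisPt ht, Complex.ofReal_exp]
  congr 1
  push_cast
  ring_nf
  rw [Complex.I_sq]
  ring

/-- **`j` is real on the imaginary axis** (its `q`-expansion has integer coefficients and
`q = e^{-2πt}` is real there). [folklore] -/
theorem kleinJ_axisPt_im {t : ℝ} (ht : 0 < t) : (kleinJ (axisPt t)).im = 0 := by
  have h := hasSum_formalXJ (axisPt t)
  rw [qParam_axisPt ht] at h
  set r : ℝ := Real.exp (-(2 * Real.pi * t)) with hr
  have hr0 : r ≠ 0 := (Real.exp_pos _).ne'
  have him : HasSum (fun n : ℕ ↦ ((((PowerSeries.coeff n formalXJ : ℤ) : ℂ) * (r : ℂ) ^ n)).im)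
      (((r : ℂ) * kleinJ (axisPt t))).im := Complex.hasSum_im h
  have h0 : (fun n : ℕ ↦ ((((PowerSeries.coeff n formalXJ : ℤ) : ℂ) * (r : ℂ) ^ n)).im) = 0 := by
    funext n
    rw [show (((PowerSeries.coeff n formalXJ : ℤ) : ℂ) * (r : ℂ) ^ n)
      = (((PowerSeries.coeff n formalXJ : ℤ) * r ^ n : ℝ) : ℂ) by push_cast; ring]
    exact Complex.ofReal_im _
  rw [h0] at him
  have := him.unique hasSum_zero
  rw [Complex.mul_im, Complex.ofReal_re, Complex.ofReal_im, zero_mul, add_zero] at this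
  exact (mul_eq_zero.mp this).resolve_left hr0

/-- On the axis, `j(it) = axisJ t` as a complex number. [folklore] -/
theorem kleinJ_axisPt {t : ℝ} (ht : 0 < t) : kleinJ (axisPt t) = (axisJ t : ℂ) := by
  apply Complex.ext <;> simp [axisJ, kleinJ_axisPt_im ht]

/-- `axisJ 1 = j(i) = 1728`. [folklore] -/
@[simp] theorem axisJ_one : axisJ 1 = 1728 := by
  simp [axisJ, kleinJ_I]

/-- For `t > 1` the point `it` lies in the open fundamental domain `𝒟ᵒ`. [folklore] -/
theorem axisPt_mem_fdo {t : ℝ} (ht : 1 < t) : axisPt t ∈ ModularGroup.fdo := by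
  have ht0 : 0 < t := one_pos.trans ht
  constructor
  · rw [coe_axisPt ht0, Complex.normSq_mul, Complex.normSq_I, Complex.normSq_ofReal, mul_one]
    nlinarith
  · rw [re_axisPt ht0, abs_zero]; norm_num

/-- **`t ↦ j(it)` is injective on `[1, ∞)`**: two points of the closure of the fundamental domain on
the imaginary axis with the same `j` are `SL₂(ℤ)`-equivalent (`kleinJ_eq_kleinJ_iff`), hence equal
(Mathlib's `ModularGroup.eq_smul_self_of_mem_fdo_mem_fdo`,
`ModularGroup.eq_one_or_neg_one_of_mem_fdo_mem_fd`). [folklore] -/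
theorem injOn_axisJ : InjOn axisJ (Ici 1) := by
  -- first: `j(it) = j(is)` with `t > 1`, `s ≥ 1` forces `s = t`
  have key : ∀ {s t : ℝ}, 1 ≤ s → 1 < t → axisJ s = axisJ t → s = t := by
    intro s t hs ht hj
    have hs0 : 0 < s := one_pos.trans_le hs
    have ht0 : 0 < t := one_pos.trans ht
    have hj' : kleinJ (axisPt s) = kleinJ (axisPt t) := by
      rw [kleinJ_axisPt hs0, kleinJ_axisPt ht0, hj]
    obtain ⟨γ, hγ⟩ := kleinJ_eq_kleinJ_iff.mp hj'
    rcases hs.eq_or_lt with rfl | hs1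
    · -- `s = 1`: `γ • i = it ∈ 𝒟ᵒ`, so `γ⁻¹ • (it) = i ∈ 𝒟` forces `γ = ±1`
      exfalso
      have h1 : γ⁻¹ • axisPt t = UpperHalfPlane.I := by
        rw [← hγ, inv_smul_smul, axisPt_one]
      have hmem : γ⁻¹ • axisPt t ∈ ModularGroup.fd := by
        rw [h1]
        refine ⟨by simp [Complex.normSq_I], by simp⟩
      have hγ1 := ModularGroup.eq_one_or_neg_one_of_mem_fdo_mem_fd (axisPt_mem_fdo ht) hmem
      have hfix : axisPt t = UpperHalfPlane.I := by
        rcases hγ1 with h | h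
        · rw [← h1, h, one_smul]
        · rw [← h1, h, ModularGroup.SL_neg_smul, one_smul]
      have := congrArg UpperHalfPlane.im hfix
      rw [im_axisPt ht0, UpperHalfPlane.I_im] at this
      exact ht.ne' this
    · have heq := ModularGroup.eq_smul_self_of_mem_fdo_mem_fdo (axisPt_mem_fdo hs1)
        (hγ ▸ axisPt_mem_fdo ht)
      have := congrArg UpperHalfPlane.im (heq.trans hγ)
      rwa [im_axisPt hs0, im_axisPt ht0] at this
  intro s hs t ht hst
  rcases (show (1 : ℝ) ≤ t from ht).eq_or_lt with rfl | ht1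
  · rcases (show (1 : ℝ) ≤ s from hs).eq_or_lt with rfl | hs1
    · rfl
    · exact (key le_rfl hs1 hst.symm).symm
  · exact key hs ht1 hst

/-- **Derivative along the axis**: `d/dt j(it) = j'(it) · i`. [folklore] -/
theorem hasDerivAt_kleinJ_axisPt {t : ℝ} (ht : 0 < t) :
    HasDerivAt (fun s : ℝ ↦ kleinJ (axisPt s)) (deriv (kleinJ ∘ ofComplex) ((t : ℂ) * I) * I) t := by
  have hd : DifferentiableAt ℂ (kleinJ ∘ ofComplex) ((t : ℂ) * I) :=
    differentiableOn_kleinJ.differentiableAt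
      (UpperHalfPlane.isOpen_upperHalfPlaneSet.mem_nhds (by simpa using ht))
  have h1 : HasDerivAt (fun s : ℝ ↦ (s : ℂ) * I) (1 * I) t :=
    ((hasDerivAt_id (t : ℂ)).comp_ofReal).mul_const I
  rw [one_mul] at h1
  exact hd.hasDerivAt.comp t h1

/-- `t ↦ j(it)` is continuous on `(0, ∞)`. [folklore] -/
theorem continuousOn_kleinJ_axisPt : ContinuousOn (fun t : ℝ ↦ kleinJ (axisPt t)) (Ioi 0) :=
  fun _ ht ↦ (hasDerivAt_kleinJ_axisPt ht).continuousAt.continuousWithinAt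

/-- `axisJ` is continuous on `(0, ∞)`. [folklore] -/
theorem continuousOn_axisJ : ContinuousOn axisJ (Ioi 0) :=
  Complex.continuous_re.comp_continuousOn continuousOn_kleinJ_axisPt

/-- The real derivative `D(t) = re (j'(it) i)` of `axisJ`. [folklore] -/
def axisJDeriv (t : ℝ) : ℝ := (deriv (kleinJ ∘ ofComplex) ((t : ℂ) * I) * I).re

/-- `axisJ` has derivative `axisJDeriv`. [folklore] -/
theorem hasDerivAt_axisJ {t : ℝ} (ht : 0 < t) : HasDerivAt axisJ (axisJDeriv t) t := by
  exact (Complex.reCLM.hasFDerivAt).comp_hasDerivAt t (hasDerivAt_kleinJ_axisPt ht)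

/-- The complex derivative along the axis is real: `im (j'(it) i) = 0` (the imaginary part of
`j(it)` is identically `0`). [folklore] -/
theorem deriv_kleinJ_axisPt_mul_I_im {t : ℝ} (ht : 0 < t) :
    (deriv (kleinJ ∘ ofComplex) ((t : ℂ) * I) * I).im = 0 := by
  have h := hasDerivAt_kleinJ_axisPt ht
  have him : HasDerivAt (fun s : ℝ ↦ (kleinJ (axisPt s)).im)
      (deriv (kleinJ ∘ ofComplex) ((t : ℂ) * I) * I).im t := by
    exact (Complex.imCLM.hasFDerivAt).comp_hasDerivAt t h
  have h0 : HasDerivAt (fun s : ℝ ↦ (kleinJ (axisPt s)).im) 0 t := by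
    refine (hasDerivAt_const t (0 : ℝ)).congr_of_eventuallyEq ?_
    filter_upwards [isOpen_Ioi.mem_nhds ht] with s hs
    exact kleinJ_axisPt_im hs
  exact him.unique h0

/-- No `SL₂(ℤ)`-translate of a point of the closed fundamental domain `𝒟` lies on the open
half-axis `{it | t > 1}` unless it is that point itself. [folklore] -/
theorem eq_axisPt_of_smul_eq {t : ℝ} (ht : 1 < t) {z : ℍ} (hz : z ∈ ModularGroup.fd) {γ : SL(2, ℤ)}
    (hγ : γ • z = axisPt t) : z = axisPt t := by
  have h1 : γ⁻¹ • axisPt t = z := by rw [← hγ, inv_smul_smul]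
  have hγ1 := ModularGroup.eq_one_or_neg_one_of_mem_fdo_mem_fd (axisPt_mem_fdo ht) (h1 ▸ hz)
  rcases hγ1 with h | h
  · rw [← h1, h, one_smul]
  · rw [← h1, h, ModularGroup.SL_neg_smul, one_smul]

/-- `E₆(it) ≠ 0` for `t > 1` (the zeros of `E₆` are the orbit of `i`). [folklore] -/
theorem E₆_axisPt_ne_zero {t : ℝ} (ht : 1 < t) : E₆ (axisPt t) ≠ 0 := by
  intro h
  obtain ⟨γ, hγ⟩ := E₆_eq_zero_iff.mp h
  have hI : UpperHalfPlane.I ∈ ModularGroup.fd := ⟨by simp [Complex.normSq_I], by simp⟩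
  have := congrArg UpperHalfPlane.im (eq_axisPt_of_smul_eq ht hI hγ)
  rw [im_axisPt (one_pos.trans ht), UpperHalfPlane.I_im] at this
  exact ht.ne' this.symm

/-- `E₄(it) ≠ 0` for `t > 1` (the zeros of `E₄` are the orbit of `ρ`). [folklore] -/
theorem E₄_axisPt_ne_zero {t : ℝ} (ht : 1 < t) : E₄ (axisPt t) ≠ 0 := by
  intro h
  obtain ⟨γ, hγ⟩ := E₄_eq_zero_iff.mp h
  have := congrArg UpperHalfPlane.re (eq_axisPt_of_smul_eq ht ModularGroup.ρ_mem_fd hγ)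
  rw [re_axisPt (one_pos.trans ht), show UpperHalfPlane.ρ.re = -1 / 2 from rfl] at this
  norm_num at this

/-- `j'(it) ≠ 0` for `t > 1`. [folklore] -/
theorem deriv_kleinJ_axisPt_ne_zero {t : ℝ} (ht : 1 < t) :
    deriv (kleinJ ∘ ofComplex) ((t : ℂ) * I) ≠ 0 := by
  have := (deriv_kleinJ_ne_zero_iff (axisPt t)).mpr ⟨E₄_axisPt_ne_zero ht, E₆_axisPt_ne_zero ht⟩
  rwa [coe_axisPt (one_pos.trans ht)] at this

/-- The derivative along the axis as a real number: `j'(it) i = axisJDeriv t`. [folklore] -/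
theorem deriv_kleinJ_axisPt_mul_I {t : ℝ} (ht : 0 < t) :
    deriv (kleinJ ∘ ofComplex) ((t : ℂ) * I) * I = (axisJDeriv t : ℂ) := by
  apply Complex.ext
  · simp [axisJDeriv]
  · rw [deriv_kleinJ_axisPt_mul_I_im ht, Complex.ofReal_im]

/-- `axisJDeriv t ≠ 0` for `t > 1`. [folklore] -/
theorem axisJDeriv_ne_zero {t : ℝ} (ht : 1 < t) : axisJDeriv t ≠ 0 := by
  intro h
  have := deriv_kleinJ_axisPt_mul_I (one_pos.trans ht)
  rw [h, Complex.ofReal_zero, mul_eq_zero] at this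
  exact this.elim (deriv_kleinJ_axisPt_ne_zero ht) Complex.I_ne_zero

/-! ### Growth of `j(it)` and the order structure of the coordinate -/

/-- `e^{-4π} ≤ 10⁻⁴`. [folklore] -/
theorem exp_neg_four_pi_le : Real.exp (-(2 * Real.pi * 2)) ≤ 1 / 10 ^ 4 := by
  have h3 : Real.exp (-(2 * Real.pi * 2)) ≤ Real.exp (-12) := by
    apply Real.exp_le_exp.mpr
    have := Real.pi_gt_three
    linarith
  refine h3.trans ?_
  rw [Real.exp_neg, one_div]
  apply inv_anti₀ (by positivity)
  have h1 : (2.7182818283 : ℝ) < Real.exp 1 := Real.exp_one_gt_d9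
  have h2 : Real.exp 12 = Real.exp 1 ^ 12 := by rw [Real.exp_one_pow]; norm_num
  rw [h2]
  have h4 : (10 : ℝ) ^ 4 ≤ 2.7182818283 ^ 12 := by norm_num
  exact h4.trans (pow_le_pow_left₀ (by norm_num) h1.le 12)

/-- **Growth on the axis**: `axisJ t > 6t + 700` for `t ≥ 2`, from
`j = 1/q + 744 + O(q)` (`norm_E₄_cube_div_discriminant_sub_sub_le`) with `q = e^{-2πt} ≤ 10⁻⁴` and
`1/q = e^{2πt} ≥ 1 + 2πt`. [folklore] -/
theorem axisJ_gt {t : ℝ} (ht : 2 ≤ t) : 6 * t + 700 < axisJ t := by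
  have ht0 : 0 < t := by linarith
  set r : ℝ := Real.exp (-(2 * Real.pi * t)) with hr
  have hr0 : 0 < r := Real.exp_pos _
  have hrle : r ≤ 1 / 10 ^ 4 := by
    refine le_trans (Real.exp_le_exp.mpr ?_) exp_neg_four_pi_le
    have := Real.pi_pos
    nlinarith
  have hq : Function.Periodic.qParam 1 (axisPt t : ℂ) = (r : ℂ) := qParam_axisPt ht0
  have hnorm : ‖Function.Periodic.qParam 1 (axisPt t : ℂ)‖ = r := by
    rw [hq, Complex.norm_real, Real.norm_of_nonneg hr0.le]
  have hest := norm_E₄_cube_div_discriminant_sub_sub_le (axisPt t) (by rw [hnorm]; exact hrle)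
  rw [hnorm, hq] at hest
  have hj : ModularForm.E₄ (axisPt t) ^ 3 / ModularForm.discriminant (axisPt t) = (axisJ t : ℂ) :=
    kleinJ_axisPt ht0
  rw [hj] at hest
  have hre : |((axisJ t : ℂ) - (r : ℂ)⁻¹ - 744).re| ≤ 400000 * r :=
    (Complex.abs_re_le_norm _).trans hest
  have hre' : ((axisJ t : ℂ) - (r : ℂ)⁻¹ - 744).re = axisJ t - r⁻¹ - 744 := by
    rw [← Complex.ofReal_inv]; simp
  rw [hre'] at hre
  have h1 : r⁻¹ - 744 + (axisJ t - r⁻¹ - 744) ≤ axisJ t := by linarith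
  have h2 : -(400000 * r) ≤ axisJ t - r⁻¹ - 744 := (abs_le.mp hre).1
  have h3 : 400000 * r ≤ 40 := by
    have : r ≤ 1 / 10 ^ 4 := hrle
    linarith
  -- `1/r = e^{2πt} ≥ 1 + 2πt > 6t`
  have h4 : 6 * t < r⁻¹ := by
    rw [hr, ← Real.exp_neg, neg_neg]
    have h5 := Real.add_one_le_exp (2 * Real.pi * t)
    have h6 : 6 * t < 2 * Real.pi * t := by
      have := Real.pi_gt_three
      nlinarith
    linarith
  linarith

/-- **`axisJ` is strictly increasing on `[1, ∞)`.** [folklore] -/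
theorem strictMonoOn_axisJ : StrictMonoOn axisJ (Ici 1) := by
  intro s hs t ht hst
  set B : ℝ := max t 200 with hB
  have hB2 : (2 : ℝ) ≤ B := le_trans (by norm_num) (le_max_right _ _)
  have hmono : StrictMonoOn axisJ (Icc 1 B) := by
    refine ContinuousOn.strictMonoOn_of_injOn_Icc (by linarith) ?_ ?_ ?_
    · rw [axisJ_one]
      have := axisJ_gt hB2
      linarith [le_max_right t 200]
    · exact continuousOn_axisJ.mono fun x hx ↦ lt_of_lt_of_le one_pos hx.1
    · exact injOn_axisJ.mono fun x hx ↦ hx.1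
  exact hmono ⟨hs, (le_of_lt hst).trans (le_max_left _ _)⟩ ⟨ht, le_max_left _ _⟩ hst

/-- `axisJ t > 1728` for `t > 1`. [folklore] -/
theorem lt_axisJ {t : ℝ} (ht : 1 < t) : 1728 < axisJ t := by
  simpa using strictMonoOn_axisJ self_mem_Ici (le_of_lt ht) ht

/-- **Every `u ≥ 1728` is a value `j(it)`, `t ≥ 1`** (intermediate value theorem). [folklore] -/
theorem exists_axisJ_eq {u : ℝ} (hu : 1728 ≤ u) : ∃ t ∈ Ici (1 : ℝ), axisJ t = u := by
  set B : ℝ := max u 200 with hB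
  have hB2 : (2 : ℝ) ≤ B := le_trans (by norm_num) (le_max_right _ _)
  have hcont : ContinuousOn axisJ (Icc 1 B) :=
    continuousOn_axisJ.mono fun x hx ↦ lt_of_lt_of_le one_pos hx.1
  have hmem : u ∈ Icc (axisJ 1) (axisJ B) := by
    rw [axisJ_one]
    refine ⟨hu, ?_⟩
    have := axisJ_gt hB2
    linarith [le_max_left u 200, le_max_right u 200]
  obtain ⟨t, ht, htu⟩ := intermediate_value_Icc (by linarith) hcont hmem
  exact ⟨t, ht.1, htu⟩

/-- For `u > 1728` the preimage lies in `(1, ∞)`. [folklore] -/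
theorem exists_axisJ_eq_of_lt {u : ℝ} (hu : 1728 < u) : ∃ t ∈ Ioi (1 : ℝ), axisJ t = u := by
  obtain ⟨t, ht, htu⟩ := exists_axisJ_eq hu.le
  refine ⟨t, ?_, htu⟩
  rcases (show (1 : ℝ) ≤ t from ht).eq_or_lt with rfl | h
  · rw [axisJ_one] at htu; exact absurd htu hu.ne
  · exact h

/-- **The inverse branch**: for `u > 1728`, `t₊(u) > 1` and `j(i t₊(u)) = u`. [folklore] -/
theorem axisParam_spec {u : ℝ} (hu : 1728 < u) : axisParam u ∈ Ioi 1 ∧ axisJ (axisParam u) = u :=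
  Function.invFunOn_pos (exists_axisJ_eq_of_lt hu)

/-- `t₊(u) > 1` for `u > 1728`. [folklore] -/
theorem one_lt_axisParam {u : ℝ} (hu : 1728 < u) : 1 < axisParam u := (axisParam_spec hu).1

/-- `j(i t₊(u)) = u` for `u > 1728`. [folklore] -/
@[simp] theorem axisJ_axisParam {u : ℝ} (hu : 1728 < u) : axisJ (axisParam u) = u :=
  (axisParam_spec hu).2

/-- `t₊(j(it)) = t` for `t > 1`. [folklore] -/
@[simp] theorem axisParam_axisJ {t : ℝ} (ht : 1 < t) : axisParam (axisJ t) = t :=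
  (injOn_axisJ.mono Ioi_subset_Ici_self).leftInvOn_invFunOn ht

/-- `kleinJ (i t₊(u)) = u` for `u > 1728`. [folklore] -/
theorem kleinJ_axisPt_axisParam {u : ℝ} (hu : 1728 < u) : kleinJ (axisPt (axisParam u)) = u := by
  rw [kleinJ_axisPt (one_pos.trans (one_lt_axisParam hu)), axisJ_axisParam hu]

/-- **The image of the open half-axis**: `j(i·(1, ∞)) = (1728, ∞)`. [folklore] -/
theorem image_axisJ_Ioi : axisJ '' Ioi 1 = Ioi 1728 := by
  ext u
  constructor
  · rintro ⟨t, ht, rfl⟩; exact lt_axisJ ht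
  · intro hu; exact ⟨axisParam u, one_lt_axisParam hu, axisJ_axisParam hu⟩

/-- The derivative of the increasing function `axisJ` is nonnegative on `(1, ∞)`. [folklore] -/
theorem axisJDeriv_nonneg {t : ℝ} (ht : 1 < t) : 0 ≤ axisJDeriv t := by
  have h1 : 0 ≤ derivWithin axisJ (Ioi 1) t :=
    (strictMonoOn_axisJ.monotoneOn.mono Ioi_subset_Ici_self).derivWithin_nonneg
  rwa [derivWithin_of_isOpen isOpen_Ioi ht, (hasDerivAt_axisJ (one_pos.trans ht)).deriv] at h1

/-- **`d/dt j(it) > 0` for `t > 1`.** [folklore] -/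
theorem axisJDeriv_pos {t : ℝ} (ht : 1 < t) : 0 < axisJDeriv t :=
  lt_of_le_of_ne (axisJDeriv_nonneg ht) (axisJDeriv_ne_zero ht).symm

/-- **The quotient `ω/dj`**: for a function `φ` of weight `2` (differential `ω = 2πi φ(z) dz`),
`djQuot φ = 2πi φ / j' = -φ Δ / (E₄² E₆)` by Ramanujan's `j' = -2πi E₄²E₆/Δ`
(`deriv_kleinJ_comp_ofComplex`; Zagier, *1-2-3 of modular forms*, §5.1 (53)), so that `ω = djQuot φ · dj`.
Written derivative-free it is a quotient of weight-`14` forms, i.e. an element of the function field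
(`ω_f/dj ∈ ℂ(X₀(N)) = ℂ(j, j_N)` for `φ = f ∈ S₂(Γ₀(N))`, Diamond–Shurman Prop. 7.5.1), and for `f`
with rational coefficients its `q`-expansion is rational. [cite: DiamondShurman2005, §7.5 Prop. 7.5.1] -/
def djQuot (φ : ℍ → ℂ) (τ : ℍ) : ℂ :=
  -(φ τ * ModularForm.discriminant τ) / (E₄ τ ^ 2 * E₆ τ)

/-- **The canonical integrand** of the half-arc integral `2πi ∫_i^{i∞} φ(z) dz` in the coordinate
`u = j`: `arcIntegrand φ u = (ω/dj)(i t₊(u)) = djQuot φ (i t₊(u))`, `u > 1728`, so that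
`∫_{1728}^{∞} arcIntegrand φ u du = 2πi ∫_i^{i∞} φ dz` (`integral_arcIntegrand`) — the substitution
of a modular function for the variable of integration of Kontsevich–Zagier §3.4. [cite: KontsevichZagier2001, §3.4] -/
def arcIntegrand (φ : ℍ → ℂ) (u : ℝ) : ℂ := djQuot φ (axisPt (axisParam u))

/-- **The domain of integration** `{u | 1728 < u} ⊆ ℝ¹ = (Fin 1 → ℝ)`: the `j`-image of the open
half-axis `{it | t > 1}` (`image_axisJ_Ioi`), a `ℚ`-semialgebraic set (`isSemialgebraic_arcDomain`)
as the calculus requires. [cite: KontsevichZagier2001, §1.1] -/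
def arcDomain : Set (Fin 1 → ℝ) := {x | 1728 < x 0}

/-- `arcDomain` is `ℚ`-semialgebraic. [folklore] -/
theorem isSemialgebraic_arcDomain :
    Literature.ModelTheory.ExponentialFields.IsSemialgebraic ℚ arcDomain := by
  have h := Literature.ModelTheory.ExponentialFields.isSemialgebraic_setOf_eval_pos (k := ℚ)
    (R := ℝ) (MvPolynomial.X (0 : Fin 1) - MvPolynomial.C (1728 : ℚ))
  convert h using 1
  ext x
  simp [arcDomain, sub_pos]

/-- **The half-arc integral** `h(φ) = 2πi ∫_i^{i∞} φ(z) dz = 2πi · eichlerPrimitive φ i`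
(`eichlerPrimitive φ τ = ∫_τ^{i∞} φ dz` of `EichlerShimuraPeriods`): the integral of the differential
`2πi φ dz` over the upper half `{it | t > 1}` of the geodesic `{0, ∞}`. [cite: CremonaAlgorithms1997, §2.1 (2.1.1)] -/
def halfArcSymbol (φ : ℍ → ℂ) : ℂ := 2 * Real.pi * I * eichlerPrimitive φ UpperHalfPlane.I

variable {N : ℕ}

/-- **The unimodular (Manin) symbol** `⟨g⟩_f = ⟨(g), f⟩ = 2πi ∫_{g(0)}^{g(∞)} f(z) dz` of a
weight-`2` cusp form on `Γ₀(N)` at `g ∈ SL₂(ℤ)` (Cremona: `(g) = {g(0), g(∞)}`, (2.1.6), paired with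
`f` by `⟨γ, f⟩ = ∫_γ 2πi f(z) dz`, (2.1.1)), computed by splitting the arc `g·(it)` at `g·i`:
`∫_{g·i}^{g·∞} = h(f ∣ g)` and, since `g·(i/t) = gS·(it)`, `∫_{g·0}^{g·i} = -h(f ∣ gS)`; so
`⟨g⟩_f = h(f ∣ g) - h(f ∣ gS)`.  Equals `2πi (c_f(g) - c_f(gS))` for the tree's period cocycle
(`unimodularSymbol_eq_periodFn`) and satisfies `⟨gS⟩ = -⟨g⟩` (`unimodularSymbol_mul_S`, Cremona
(2.1.4)). [cite: CremonaAlgorithms1997, §2.1 (2.1.1), (2.1.6)] -/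
def unimodularSymbol (f : CuspForm (Gamma0 N) 2) (g : SL(2, ℤ)) : ℂ :=
  halfArcSymbol (⇑f ∣[(2 : ℤ)] g) - halfArcSymbol (⇑f ∣[(2 : ℤ)] (g * ModularGroup.S))

/-- Weight two: the period cocycle of `EichlerShimuraPeriods` is
`periodFn 0 f g p = ∫_i^{i∞} (f ∣ g) - ∫_{g i}^{i∞} f` (independent of `p`). [cite: Shimura1971, §8.2 (8.2.20)] -/
theorem periodFn_zero_eq [NeZero N] (f : CuspForm (Gamma0 N) 2) (g : SL(2, ℤ)) (p : Fin 2 → ℂ) :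
    periodFn 0 f g p = eichlerPrimitive (⇑f ∣[(2 : ℤ)] g) UpperHalfPlane.I -
      eichlerPrimitive ⇑f (g • UpperHalfPlane.I) := by
  simp only [periodFn, eichlerKernel, Nat.cast_zero, zero_add, Finset.range_one, Finset.sum_singleton,
    Nat.choose_self, Nat.cast_one, one_mul, powPrimitive_zero, pow_zero, mul_one, Nat.sub_self]
  rfl

/-- **`⟨g⟩_f = 2πi (c_f(g) - c_f(gS))`** in terms of the tree's period cocycle `periodFn 0`
(for any `p`; `gS·i = g·i`). [cite: Shimura1971, §8.2 (8.2.20)] -/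
theorem unimodularSymbol_eq_periodFn [NeZero N] (f : CuspForm (Gamma0 N) 2) (g : SL(2, ℤ))
    (p : Fin 2 → ℂ) :
    unimodularSymbol f g = 2 * Real.pi * I * (periodFn 0 f g p - periodFn 0 f (g * ModularGroup.S) p) := by
  have hS : ModularGroup.S • UpperHalfPlane.I = UpperHalfPlane.I := by
    apply UpperHalfPlane.ext
    rw [UpperHalfPlane.modular_S_smul]
    simp
  rw [periodFn_zero_eq, periodFn_zero_eq, mul_smul, hS, unimodularSymbol, halfArcSymbol, halfArcSymbol]
  ring

/-! ### Admissibility and the KZ representations -/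

/-- **Admissibility of the canonical half-arc integrand** `arcIntegrand φ` for the Kontsevich–Zagier
calculus: its real and imaginary parts are `ℚ`-semialgebraic functions on `arcDomain = (1728, ∞)`
(their graphs are `ℚ`-semialgebraic subsets of `ℝ²`, `IsSemialgebraicFunOn` of
`Transcendental/SemialgebraicMaps`) and it is absolutely integrable there — exactly the fields of
`KZ.IntegralRep` beyond the (semialgebraic) domain.  Integrability holds for every cusp function
(`HalfArcAdmissible.of_isCuspFunction`); semialgebraicity is the arithmetic-geometric input (the
named fact `isSemialgebraicFunOn_arcIntegrand_slash` for rational cusp forms).  A hypothesis, never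
an existence claim.
[cite: KontsevichZagier2001, §1.1 Definition] -/
structure HalfArcAdmissible (φ : ℍ → ℂ) : Prop where
  isSemialgebraicFunOn_re :
    IsSemialgebraicFunOn ℚ arcDomain (fun x => (arcIntegrand φ (x 0)).re)
  isSemialgebraicFunOn_im :
    IsSemialgebraicFunOn ℚ arcDomain (fun x => (arcIntegrand φ (x 0)).im)
  integrableOn : IntegrableOn (fun x : Fin 1 → ℝ => arcIntegrand φ (x 0)) arcDomain

/-- **The KZ representation of `re (2πi ∫_i^{i∞} φ(z) dz)`**: domain `(1728, ∞) ⊆ ℝ¹`, integrand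
`u ↦ re (ω/dj)(i t₊(u))`; its value is `re (halfArcSymbol φ)` (`halfArcRepRe_value`).
[cite: KontsevichZagier2001, §1.1 Definition and §3.4] -/
def halfArcRepRe (φ : ℍ → ℂ) (h : HalfArcAdmissible φ) :
    Literature.NumberTheory.Transcendental.KZ.IntegralRep 1 where
  domain := arcDomain
  integrand x := (arcIntegrand φ (x 0)).re
  isSemialgebraic_domain := isSemialgebraic_arcDomain
  isSemialgebraicFunOn_integrand := h.isSemialgebraicFunOn_re
  integrableOn := h.integrableOn.re

/-- **The KZ representation of `im (2πi ∫_i^{i∞} φ(z) dz)`**: domain `(1728, ∞) ⊆ ℝ¹`, integrand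
`u ↦ im (ω/dj)(i t₊(u))`; its value is `im (halfArcSymbol φ)` (`halfArcRepIm_value`).
[cite: KontsevichZagier2001, §1.1 Definition and §3.4] -/
def halfArcRepIm (φ : ℍ → ℂ) (h : HalfArcAdmissible φ) :
    Literature.NumberTheory.Transcendental.KZ.IntegralRep 1 where
  domain := arcDomain
  integrand x := (arcIntegrand φ (x 0)).im
  isSemialgebraic_domain := isSemialgebraic_arcDomain
  isSemialgebraicFunOn_integrand := h.isSemialgebraicFunOn_im
  integrableOn := h.integrableOn.im

/-- **`ModularSymbolRep f g`: the modular symbol `⟨g⟩_f = 2πi ∫_{g0}^{g∞} f(z) dz` admits its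
canonical Kontsevich–Zagier representation** — both half-arcs `g·{it | t > 1}` (integrand `f ∣ g`)
and `g·{it | t < 1}` reversed (`= gS·{it | t > 1}`, integrand `f ∣ gS`) have admissible canonical
integrands in the coordinate `u = j`.  An inhabitant `ρ` yields the formal KZ classes `ρ.classRe`,
`ρ.classIm` of the real and imaginary parts of the period `⟨g⟩_f`, with `KZ.eval ρ.classRe = re ⟨g⟩_f`
(`eval_classRe`).  A `Prop`: the representation is canonical, only its admissibility is asserted;
for `f` with rational Fourier coefficients it holds for every `g` (`ModularSymbolRep.of_hasRatCoeffs`,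
from the named fact `isSemialgebraicFunOn_arcIntegrand_slash`).
[cite: KontsevichZagier2001, §3.4] -/
structure ModularSymbolRep (f : CuspForm (Gamma0 N) 2) (g : SL(2, ℤ)) : Prop where
  upper : HalfArcAdmissible (⇑f ∣[(2 : ℤ)] g)
  lower : HalfArcAdmissible (⇑f ∣[(2 : ℤ)] (g * ModularGroup.S))

namespace ModularSymbolRep

variable {f : CuspForm (Gamma0 N) 2} {g : SL(2, ℤ)}

/-- **The KZ class of `re ⟨g⟩_f`**: `[re h(f ∣ g)] - [re h(f ∣ gS)] ∈ KZ.FormalRep`, evaluating to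
`re ⟨g⟩_f` (`eval_classRe`). [cite: KontsevichZagier2001, §1.2] -/
def classRe (ρ : ModularSymbolRep f g) : Literature.NumberTheory.Transcendental.KZ.FormalRep :=
  Literature.NumberTheory.Transcendental.KZ.of (halfArcRepRe _ ρ.upper) -
    Literature.NumberTheory.Transcendental.KZ.of (halfArcRepRe _ ρ.lower)

/-- **The KZ class of `im ⟨g⟩_f`**: `[im h(f ∣ g)] - [im h(f ∣ gS)] ∈ KZ.FormalRep`, evaluating to
`im ⟨g⟩_f` (`eval_classIm`). [cite: KontsevichZagier2001, §1.2] -/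
def classIm (ρ : ModularSymbolRep f g) : Literature.NumberTheory.Transcendental.KZ.FormalRep :=
  Literature.NumberTheory.Transcendental.KZ.of (halfArcRepIm _ ρ.upper) -
    Literature.NumberTheory.Transcendental.KZ.of (halfArcRepIm _ ρ.lower)

end ModularSymbolRep

/-! ### The value of the canonical representation -/

/-- **The Jacobian identity on the axis**: for `t > 1`,
`|d/dt j(it)| · (2πi φ/j')(it) = -2π φ(it)`, i.e. `djQuot φ (it) · axisJDeriv t = -2π φ(it)`
(Ramanujan's `j' = -2πi E₄²E₆/Δ`). [folklore] -/
theorem abs_axisJDeriv_smul_djQuot {t : ℝ} (ht : 1 < t) (φ : ℍ → ℂ) :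
    |axisJDeriv t| • djQuot φ (axisPt t) = -(2 * Real.pi) * φ (axisPt t) := by
  have ht0 : 0 < t := one_pos.trans ht
  rw [abs_of_pos (axisJDeriv_pos ht), Complex.real_smul, ← deriv_kleinJ_axisPt_mul_I ht0,
    ← coe_axisPt ht0, deriv_kleinJ_comp_ofComplex (axisPt t), djQuot]
  have h4 := E₄_axisPt_ne_zero ht
  have h6 := E₆_axisPt_ne_zero ht
  have hΔ := ModularForm.discriminant_ne_zero (axisPt t)
  field_simp
  ring_nf
  rw [Complex.I_sq]
  ring

/-- Transport of the integral over `ℝ¹` to `ℝ`. [folklore] -/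
theorem setIntegral_arcDomain (G : ℝ → ℂ) :
    ∫ x in arcDomain, G (x 0) = ∫ u in Ioi (1728 : ℝ), G u := by
  have hmp := volume_preserving_funUnique (Fin 1) ℝ
  have h := hmp.setIntegral_preimage_emb (MeasurableEquiv.funUnique (Fin 1) ℝ).measurableEmbedding
    G (Ioi 1728)
  have hpre : (MeasurableEquiv.funUnique (Fin 1) ℝ) ⁻¹' Ioi 1728 = arcDomain := by
    ext x
    simp [arcDomain, MeasurableEquiv.funUnique, Fin.default_eq_zero]
  rw [hpre] at h
  exact Eq.trans rfl h

/-- Translation `t ↦ t + 1` on the axis: `∫_{1}^{∞} φ(it) dt = ∫_{0}^{∞} φ(i + it) dt`. [folklore] -/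
theorem setIntegral_Ioi_one_axisPt (φ : ℍ → ℂ) :
    ∫ t in Ioi (1 : ℝ), φ (axisPt t) =
      ∫ t in Ioi (0 : ℝ), φ (ofComplex ((UpperHalfPlane.I : ℂ) + t * I)) := by
  have h := (measurePreserving_add_right volume (1 : ℝ)).setIntegral_preimage_emb
    (measurableEmbedding_addRight 1) (fun s ↦ φ (axisPt s)) (Ioi 1)
  rw [Set.preimage_add_const_Ioi, sub_self] at h
  rw [← h]
  refine setIntegral_congr_fun measurableSet_Ioi fun t _ ↦ ?_
  show φ (ofComplex (((t + 1 : ℝ) : ℂ) * I)) = φ (ofComplex ((UpperHalfPlane.I : ℂ) + (t : ℂ) * I))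
  rw [UpperHalfPlane.coe_I]
  congr 2
  push_cast
  ring

/-- **The value of the canonical representation**: for every `φ : ℍ → ℂ`,
`∫_{u > 1728} (2πi φ/j')(i t₊(u)) du = 2πi ∫_i^{i∞} φ(z) dz`, by the change of variables
`u = j(it)` on `(1, ∞)` (`integral_image_eq_integral_abs_deriv_smul`; both sides carry
Mathlib's junk value `0` when the integrals diverge, so no hypothesis on `φ` is needed).
[folklore] -/
theorem integral_arcIntegrand (φ : ℍ → ℂ) :
    ∫ x in arcDomain, arcIntegrand φ (x 0) = halfArcSymbol φ := by
  rw [setIntegral_arcDomain, ← image_axisJ_Ioi,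
    integral_image_eq_integral_abs_deriv_smul measurableSet_Ioi
      (fun t ht ↦ (hasDerivAt_axisJ (one_pos.trans ht)).hasDerivWithinAt)
      (injOn_axisJ.mono Ioi_subset_Ici_self) (arcIntegrand φ)]
  have hcongr : ∀ t ∈ Ioi (1 : ℝ),
      |axisJDeriv t| • arcIntegrand φ (axisJ t) = -(2 * Real.pi) * φ (axisPt t) := by
    intro t ht
    rw [arcIntegrand, axisParam_axisJ ht, abs_axisJDeriv_smul_djQuot ht]
  rw [setIntegral_congr_fun measurableSet_Ioi hcongr, integral_const_mul, setIntegral_Ioi_one_axisPt,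
    halfArcSymbol, eichlerPrimitive]
  generalize (∫ t in Ioi (0 : ℝ), φ (ofComplex ((UpperHalfPlane.I : ℂ) + t * I))) = A
  ring_nf
  rw [Complex.I_sq]
  ring

/-- **Value of the real half-arc representation**: `re (2πi ∫_i^{i∞} φ)`. [folklore] -/
theorem halfArcRepRe_value (φ : ℍ → ℂ) (h : HalfArcAdmissible φ) :
    (halfArcRepRe φ h).value = (halfArcSymbol φ).re := by
  rw [← integral_arcIntegrand φ]
  show ∫ x in arcDomain, (arcIntegrand φ (x 0)).re = _
  have := integral_re h.integrableOn
  simpa using this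

/-- **Value of the imaginary half-arc representation**: `im (2πi ∫_i^{i∞} φ)`. [folklore] -/
theorem halfArcRepIm_value (φ : ℍ → ℂ) (h : HalfArcAdmissible φ) :
    (halfArcRepIm φ h).value = (halfArcSymbol φ).im := by
  rw [← integral_arcIntegrand φ]
  show ∫ x in arcDomain, (arcIntegrand φ (x 0)).im = _
  have := integral_im h.integrableOn
  simpa using this

/-! ### Integrability of the canonical integrand -/

/-- Transport of integrability over `ℝ¹` to `ℝ`. [folklore] -/
theorem integrableOn_arcDomain_iff (G : ℝ → ℂ) :
    IntegrableOn (fun x : Fin 1 → ℝ ↦ G (x 0)) arcDomain ↔ IntegrableOn G (Ioi (1728 : ℝ)) := by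
  have hmp := volume_preserving_funUnique (Fin 1) ℝ
  have h := hmp.integrableOn_comp_preimage
    (MeasurableEquiv.funUnique (Fin 1) ℝ).measurableEmbedding (f := G) (s := Ioi 1728)
  have hpre : (MeasurableEquiv.funUnique (Fin 1) ℝ) ⁻¹' Ioi 1728 = arcDomain := by
    ext x
    simp [arcDomain, MeasurableEquiv.funUnique, Fin.default_eq_zero]
  rw [hpre] at h
  exact Iff.trans Iff.rfl h

/-- **Integrability in the coordinate `u` is integrability along the ray**: the canonical
integrand is integrable on `(1728, ∞)` iff `t ↦ φ(i + it)` is integrable on `(0, ∞)`. [folklore] -/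
theorem integrableOn_arcIntegrand_iff (φ : ℍ → ℂ) :
    IntegrableOn (arcIntegrand φ) (Ioi (1728 : ℝ)) ↔
      IntegrableOn (fun t : ℝ ↦ φ (ofComplex ((UpperHalfPlane.I : ℂ) + t * I))) (Ioi 0) := by
  rw [← image_axisJ_Ioi, integrableOn_image_iff_integrableOn_abs_deriv_smul measurableSet_Ioi
    (fun t ht ↦ (hasDerivAt_axisJ (one_pos.trans ht)).hasDerivWithinAt)
    (injOn_axisJ.mono Ioi_subset_Ici_self) (arcIntegrand φ)]
  have hcongr : EqOn (fun t ↦ |axisJDeriv t| • arcIntegrand φ (axisJ t))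
      (fun t ↦ -(2 * Real.pi) * φ (axisPt t)) (Ioi (1 : ℝ)) := by
    intro t ht
    simp only
    rw [arcIntegrand, axisParam_axisJ ht, abs_axisJDeriv_smul_djQuot ht]
  rw [integrableOn_congr_fun hcongr measurableSet_Ioi]
  have h2π : -(2 * (Real.pi : ℂ)) ≠ 0 := by
    simp [Real.pi_ne_zero]
  rw [IntegrableOn, integrable_const_mul_iff (isUnit_iff_ne_zero.mpr h2π)]
  -- translate `t ↦ t + 1`
  have h := (measurePreserving_add_right volume (1 : ℝ)).integrableOn_comp_preimage
    (measurableEmbedding_addRight 1) (f := fun s ↦ φ (axisPt s)) (s := Ioi 1)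
  rw [Set.preimage_add_const_Ioi, sub_self] at h
  rw [← IntegrableOn, ← h]
  refine integrableOn_congr_fun (fun t _ ↦ ?_) measurableSet_Ioi
  show φ (ofComplex (((t + 1 : ℝ) : ℂ) * I)) = φ (ofComplex ((UpperHalfPlane.I : ℂ) + (t : ℂ) * I))
  rw [UpperHalfPlane.coe_I]
  congr 2
  push_cast
  ring

/-- **Cusp functions have integrable canonical integrands** (exponential decay along the ray,
`IsCuspFunction.integrableOn_ray`). [folklore] -/
theorem IsCuspFunction.integrableOn_arcIntegrand {h : ℝ} {φ : ℍ → ℂ} (hφ : IsCuspFunction h φ) :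
    IntegrableOn (fun x : Fin 1 → ℝ ↦ arcIntegrand φ (x 0)) arcDomain := by
  rw [integrableOn_arcDomain_iff, integrableOn_arcIntegrand_iff]
  exact hφ.integrableOn_ray UpperHalfPlane.I

/-- Admissibility from semialgebraicity alone, for cusp functions. [folklore] -/
theorem HalfArcAdmissible.of_isCuspFunction {h : ℝ} {φ : ℍ → ℂ} (hφ : IsCuspFunction h φ)
    (hre : IsSemialgebraicFunOn ℚ arcDomain (fun x => (arcIntegrand φ (x 0)).re))
    (him : IsSemialgebraicFunOn ℚ arcDomain (fun x => (arcIntegrand φ (x 0)).im)) :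
    HalfArcAdmissible φ :=
  ⟨hre, him, hφ.integrableOn_arcIntegrand⟩

namespace ModularSymbolRep

variable {f : CuspForm (Gamma0 N) 2} {g : SL(2, ℤ)}

/-- **`eval [re ⟨g⟩_f] = re ⟨g⟩_f`.** [folklore] -/
theorem eval_classRe (ρ : ModularSymbolRep f g) :
    Literature.NumberTheory.Transcendental.KZ.eval ρ.classRe = (unimodularSymbol f g).re := by
  simp [classRe, unimodularSymbol, halfArcRepRe_value]

/-- **`eval [im ⟨g⟩_f] = im ⟨g⟩_f`.** [folklore] -/
theorem eval_classIm (ρ : ModularSymbolRep f g) :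
    Literature.NumberTheory.Transcendental.KZ.eval ρ.classIm = (unimodularSymbol f g).im := by
  simp [classIm, unimodularSymbol, halfArcRepIm_value]

end ModularSymbolRep

/-! ### Continuity of the canonical integrand -/

/-- **The inverse branch `t₊` is strictly increasing on `(1728, ∞)`.** [folklore] -/
theorem strictMonoOn_axisParam : StrictMonoOn axisParam (Ioi 1728) := by
  intro u hu v hv huv
  by_contra h
  have h' : axisParam v ≤ axisParam u := not_lt.mp h
  have := strictMonoOn_axisJ.monotoneOn (le_of_lt (one_lt_axisParam hv))
    (le_of_lt (one_lt_axisParam hu)) h'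
  rw [axisJ_axisParam hu, axisJ_axisParam hv] at this
  exact absurd huv (not_lt.mpr this)

/-- The image of `(1728, ∞)` under `t₊` is `(1, ∞)`. [folklore] -/
theorem image_axisParam_Ioi : axisParam '' Ioi 1728 = Ioi 1 := by
  ext t
  constructor
  · rintro ⟨u, hu, rfl⟩; exact one_lt_axisParam hu
  · intro ht; exact ⟨axisJ t, lt_axisJ ht, axisParam_axisJ ht⟩

/-- **`t₊` is continuous on `(1728, ∞)`** (a strictly monotone map onto an open interval). [folklore] -/
theorem continuousOn_axisParam : ContinuousOn axisParam (Ioi 1728) := by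
  intro u hu
  refine (strictMonoOn_axisParam.continuousAt_of_image_mem_nhds (isOpen_Ioi.mem_nhds hu) ?_).continuousWithinAt
  rw [image_axisParam_Ioi]
  exact isOpen_Ioi.mem_nhds (one_lt_axisParam hu)

/-- A holomorphic function on `ℍ` is continuous along the axis `t ↦ it`, `t > 0`. [folklore] -/
theorem continuousOn_comp_axisPt {φ : ℍ → ℂ} (hφ : MDifferentiable 𝓘(ℂ) 𝓘(ℂ) φ) :
    ContinuousOn (fun t : ℝ ↦ φ (axisPt t)) (Ioi 0) := by
  have h1 : ContinuousOn (φ ∘ ofComplex) {z : ℂ | 0 < z.im} :=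
    (UpperHalfPlane.mdifferentiable_iff.mp hφ).continuousOn
  refine h1.comp (by fun_prop) fun t ht ↦ ?_
  simpa using ht

/-- **The quotient `ω/dj` is continuous along the open half-axis** `{it | t > 1}` (no elliptic
points there) for holomorphic `φ`. [folklore] -/
theorem continuousOn_djQuot_axisPt {φ : ℍ → ℂ} (hφ : MDifferentiable 𝓘(ℂ) 𝓘(ℂ) φ) :
    ContinuousOn (fun t : ℝ ↦ djQuot φ (axisPt t)) (Ioi 1) := by
  have hsub : Ioi (1 : ℝ) ⊆ Ioi 0 := fun t ht ↦ lt_trans one_pos (mem_Ioi.mp ht)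
  have hφc := (continuousOn_comp_axisPt hφ).mono hsub
  have h4 := (continuousOn_comp_axisPt (E₄ : ModularForm 𝒮ℒ 4).holo').mono hsub
  have h6 := (continuousOn_comp_axisPt (E₆ : ModularForm 𝒮ℒ 6).holo').mono hsub
  have hΔ : ContinuousOn (fun t : ℝ ↦ ModularForm.discriminant (axisPt t)) (Ioi 1) :=
    (continuousOn_comp_axisPt CuspForm.discriminant.holo').mono hsub
  simp only [djQuot]
  refine ((hφc.mul hΔ).neg).div ((h4.pow 2).mul h6) fun t ht ↦ ?_
  exact mul_ne_zero (pow_ne_zero _ (E₄_axisPt_ne_zero ht)) (E₆_axisPt_ne_zero ht)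

/-- **The canonical integrand of a holomorphic `φ` is continuous on `(1728, ∞)`.** [folklore] -/
theorem continuousOn_arcIntegrand {φ : ℍ → ℂ} (hφ : MDifferentiable 𝓘(ℂ) 𝓘(ℂ) φ) :
    ContinuousOn (arcIntegrand φ) (Ioi 1728) :=
  (continuousOn_djQuot_axisPt hφ).comp continuousOn_axisParam fun _ hu ↦ one_lt_axisParam hu

/-! ### Linearity of the canonical integrand and the Hecke trace identity -/

/-- `djQuot` is additive in `φ`. [folklore] -/
theorem djQuot_add (φ ψ : ℍ → ℂ) (τ : ℍ) : djQuot (φ + ψ) τ = djQuot φ τ + djQuot ψ τ := by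
  simp only [djQuot, Pi.add_apply]; ring

/-- `djQuot` is homogeneous in `φ`. [folklore] -/
theorem djQuot_smul (c : ℂ) (φ : ℍ → ℂ) (τ : ℍ) : djQuot (c • φ) τ = c * djQuot φ τ := by
  simp only [djQuot, Pi.smul_apply, smul_eq_mul]; ring

/-- `djQuot` of a finite sum. [folklore] -/
theorem djQuot_finset_sum {ι : Type*} (s : Finset ι) (φ : ι → ℍ → ℂ) (τ : ℍ) :
    djQuot (∑ i ∈ s, φ i) τ = ∑ i ∈ s, djQuot (φ i) τ := by
  classical
  induction s using Finset.induction_on with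
  | empty => simp [djQuot]
  | insert a s ha ih => rw [Finset.sum_insert ha, Finset.sum_insert ha, djQuot_add, ih]

/-- The canonical integrand is additive in `φ`. [folklore] -/
theorem arcIntegrand_add (φ ψ : ℍ → ℂ) (u : ℝ) :
    arcIntegrand (φ + ψ) u = arcIntegrand φ u + arcIntegrand ψ u := djQuot_add φ ψ _

/-- The canonical integrand is homogeneous in `φ`. [folklore] -/
theorem arcIntegrand_smul (c : ℂ) (φ : ℍ → ℂ) (u : ℝ) :
    arcIntegrand (c • φ) u = c * arcIntegrand φ u := djQuot_smul c φ _

/-- The canonical integrand of a finite sum. [folklore] -/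
theorem arcIntegrand_finset_sum {ι : Type*} (s : Finset ι) (φ : ι → ℍ → ℂ) (u : ℝ) :
    arcIntegrand (∑ i ∈ s, φ i) u = ∑ i ∈ s, arcIntegrand (φ i) u := djQuot_finset_sum s φ _

/-- **The Hecke trace identity for the canonical integrands.** If `T_p f = a · f`
(`heckeT` of `HeckeOperators`, prime `p`, arithmetic normalisation: Mathlib's slash carries
`|det|^{k-1}`), then for every `g ∈ SL₂(ℤ)` and every `u`,
`a · (2πi (f|g)/j')(i t₊(u)) = Σᵢ (2πi (f|βᵢ g)/j')(i t₊(u))`, the sum over the coset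
representatives `βᵢ ∈ {(1 j; 0 p)} ∪ {(p 0; 0 1)}` (`heckeRep`, index set `HeckeIdx N p`).
This is `T_p f = Σᵢ f ∣ βᵢ` (`coe_heckeT_gamma0`, Diamond–Shurman Prop. 5.2.1) slashed by `g` and
divided by `j'`: the pointwise form of `T_p ω_f = a_p ω_f` for the differential `ω_f = 2πi f dz`.
[cite: DiamondShurman2005, Prop. 5.2.1] -/
theorem arcIntegrand_heckeT [NeZero N] (p : ℕ) [NeZero p] (hp : p.Prime)
    (f : CuspForm (Gamma0 N) 2) {a : ℂ} (hf : heckeT (Gamma0 N) 2 p f = a • f) (g : SL(2, ℤ)) (u : ℝ) :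
    a * arcIntegrand (⇑f ∣[(2 : ℤ)] g) u =
      ∑ i : HeckeIdx N p, arcIntegrand ((⇑f ∣[(2 : ℤ)] intGL (heckeRep p i.1)) ∣[(2 : ℤ)] g) u := by
  have hT := coe_heckeT_gamma0 (N := N) (k := (2 : ℤ)) p hp f
  rw [hf, CuspForm.IsGLPos.coe_smul] at hT
  have hT' : a • (⇑f ∣[(2 : ℤ)] g) =
      ∑ i : HeckeIdx N p, (⇑f ∣[(2 : ℤ)] intGL (heckeRep p i.1)) ∣[(2 : ℤ)] g := by
    rw [← ModularForm.SL_smul_slash, hT, SlashAction.sum_slash]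
  rw [← arcIntegrand_smul, hT', arcIntegrand_finset_sum]

/-! ### Hecke branches `u ↦ j(βᵢ · i t₊(u))` on the `u`-line -/

section Hecke

variable (p : ℕ) [Fact p.Prime]

/-- **The `p + 1` Hecke branches over the `u`-line**: `heckeBranch p i u = j(βᵢ · i t₊(u))`,
`β_∞ = (p 0; 0 1)` (`i = none`: `j(i p t₊(u))`, real) and `β_k = (1 k; 0 p)`
(`i = some k`: `j((i t₊(u) + k)/p)`, complex in general, `k` and `p - k` complex conjugate) — the
`p + 1` roots `w` of the modular equation `Φ_p(w, u) = 0` (`modularPolynomial_heckeBranch`), i.e. the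
images of the point with coordinate `u` under the Hecke correspondence `T_p` in the coordinate `j`.
[cite: Cox2013, §11.B (11.14)–(11.15)] -/
def heckeBranch (i : Option (ZMod p)) (u : ℝ) : ℂ := jConj i (axisPt (axisParam u))

/-- **The Hecke branches are the roots of the modular equation over the `u`-line**:
`Φ_p(heckeBranch p i u, u) = 0` for `u > 1728` (`modularPolynomial p`, Cox's `Φ_p(X, Y)` with `X`
outer). [cite: Cox2013, §11.B (11.15)] -/
theorem modularPolynomial_heckeBranch (i : Option (ZMod p)) {u : ℝ} (hu : 1728 < u) :
    ((modularPolynomial p).map (Polynomial.evalRingHom (u : ℂ))).eval (heckeBranch p i u) = 0 := by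
  rw [← kleinJ_axisPt_axisParam hu, map_kleinJ_modularPolynomial]
  exact modularPolyAt_eval_jConj i _

/-- The branch at `∞` is `j(i p t)` at `t = t₊(u)`: a value of `j` on the imaginary axis, hence
real. [folklore] -/
theorem heckeBranch_none_im {u : ℝ} (hu : 1728 < u) : (heckeBranch p none u).im = 0 := by
  have ht : 0 < axisParam u := one_pos.trans (one_lt_axisParam hu)
  have hp : (0 : ℝ) < p := Nat.cast_pos.mpr (Fact.out : p.Prime).pos
  rw [heckeBranch, jConj_none]
  have : mulPoint p (axisPt (axisParam u)) = axisPt (p * axisParam u) := by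
    apply UpperHalfPlane.ext
    rw [coe_mulPoint, coe_axisPt ht, coe_axisPt (mul_pos hp ht)]
    push_cast; ring
  rw [this]
  exact kleinJ_axisPt_im (mul_pos hp ht)

end Hecke

/-! ### The involution `S`: Manin's two-term relation holds identically -/

/-- `S² = -1` in `SL₂(ℤ)`. [folklore] -/
theorem S_mul_S : ModularGroup.S * ModularGroup.S = -1 := by
  ext i j : 2
  have := congrFun (congrFun ModularGroup.S_mul_S_eq i) j
  simpa [Matrix.SpecialLinearGroup.coe_mul] using this

/-- In weight `2` (indeed in any even weight) `φ ∣ (-γ) = φ ∣ γ`. [folklore] -/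
theorem slash_two_neg (φ : ℍ → ℂ) (γ : SL(2, ℤ)) : φ ∣[(2 : ℤ)] (-γ) = φ ∣[(2 : ℤ)] γ := by
  ext τ
  rw [ModularForm.SL_slash_apply, ModularForm.SL_slash_apply, ModularGroup.SL_neg_smul]
  congr 1
  rw [ModularGroup.denom_apply, ModularGroup.denom_apply]
  have h : ((((-γ : SL(2, ℤ)) 1 0 : ℤ) : ℂ) * (τ : ℂ) + (((-γ : SL(2, ℤ)) 1 1 : ℤ) : ℂ))
      = -((((γ 1 0 : ℤ) : ℂ)) * (τ : ℂ) + ((γ 1 1 : ℤ) : ℂ)) := by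
    simp only [Matrix.SpecialLinearGroup.coe_neg, Matrix.neg_apply, Int.cast_neg]
    ring
  rw [h, Even.neg_zpow ⟨-1, by norm_num⟩]

/-- `φ ∣ (g S S) = φ ∣ g` in weight `2`. [folklore] -/
theorem slash_mul_S_mul_S (φ : ℍ → ℂ) (g : SL(2, ℤ)) :
    φ ∣[(2 : ℤ)] (g * ModularGroup.S * ModularGroup.S) = φ ∣[(2 : ℤ)] g := by
  rw [mul_assoc, S_mul_S, mul_neg_one, slash_two_neg]

/-- **`⟨gS⟩_f = -⟨g⟩_f`** (reversal of the arc `g·(0, i∞)`). [folklore] -/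
theorem unimodularSymbol_mul_S (f : CuspForm (Gamma0 N) 2) (g : SL(2, ℤ)) :
    unimodularSymbol f (g * ModularGroup.S) = -unimodularSymbol f g := by
  rw [unimodularSymbol, unimodularSymbol, slash_mul_S_mul_S]
  ring

/-- The half-arc representation only depends on the integrand. [folklore] -/
theorem halfArcRepRe_congr {φ ψ : ℍ → ℂ} (e : φ = ψ) (h : HalfArcAdmissible φ)
    (h' : HalfArcAdmissible ψ) : halfArcRepRe φ h = halfArcRepRe ψ h' := by
  subst e; rfl

/-- The half-arc representation only depends on the integrand. [folklore] -/
theorem halfArcRepIm_congr {φ ψ : ℍ → ℂ} (e : φ = ψ) (h : HalfArcAdmissible φ)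
    (h' : HalfArcAdmissible ψ) : halfArcRepIm φ h = halfArcRepIm ψ h' := by
  subst e; rfl

namespace ModularSymbolRep

variable {f : CuspForm (Gamma0 N) 2} {g : SL(2, ℤ)}

/-- Admissibility for `gS` from admissibility for `g`: the same two half-arcs. [folklore] -/
theorem mul_S (ρ : ModularSymbolRep f g) : ModularSymbolRep f (g * ModularGroup.S) :=
  ⟨ρ.lower, (slash_mul_S_mul_S (⇑f) g).symm ▸ ρ.upper⟩

/-- **Manin's two-term relation holds identically in `FormalRep`**:
`[re ⟨g⟩_f] + [re ⟨gS⟩_f] = 0` with no move at all (the two symbols are the same two half-arc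
representations with opposite signs; Cremona (2.1.4) `(γ) + (γS) = 0`). [cite: CremonaAlgorithms1997, §2.1 (2.1.4)] -/
theorem classRe_add_classRe_mul_S (ρ : ModularSymbolRep f g)
    (ρ' : ModularSymbolRep f (g * ModularGroup.S)) : ρ.classRe + ρ'.classRe = 0 := by
  simp only [classRe]
  rw [halfArcRepRe_congr (slash_mul_S_mul_S (⇑f) g) ρ'.lower ρ.upper]
  abel

/-- The imaginary parts: `[im ⟨g⟩_f] + [im ⟨gS⟩_f] = 0` identically (Cremona (2.1.4)). [cite: CremonaAlgorithms1997, §2.1 (2.1.4)] -/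
theorem classIm_add_classIm_mul_S (ρ : ModularSymbolRep f g)
    (ρ' : ModularSymbolRep f (g * ModularGroup.S)) : ρ.classIm + ρ'.classIm = 0 := by
  simp only [classIm]
  rw [halfArcRepIm_congr (slash_mul_S_mul_S (⇑f) g) ρ'.lower ρ.upper]
  abel

end ModularSymbolRep

/-! ### Equality of integrands on the domain and the KZ moves -/

section KZHelpers

open Literature.NumberTheory.Transcendental Literature.NumberTheory.Transcendental.KZ

variable {n : ℕ}

/-- The zero representation on a `ℚ`-semialgebraic domain. [folklore] -/
def zeroRep (s : Set (Fin n → ℝ)) (hs : Literature.ModelTheory.ExponentialFields.IsSemialgebraic ℚ s) :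
    IntegralRep n where
  domain := s
  integrand := 0
  isSemialgebraic_domain := hs
  isSemialgebraicFunOn_integrand :=
    (isSemialgebraicFunOn_aeval hs (0 : MvPolynomial (Fin n) ℚ)).congr fun x _ ↦ by simp
  integrableOn := integrableOn_zero

/-- The zero representation is a relation (`[z] = [z] + [z]` by integrand additivity). [folklore] -/
theorem of_zeroRep_mem_relations (s : Set (Fin n → ℝ))
    (hs : Literature.ModelTheory.ExponentialFields.IsSemialgebraic ℚ s) : of (zeroRep s hs) ∈ relations := by
  have h : of (zeroRep s hs) - of (zeroRep s hs) - of (zeroRep s hs) ∈ relations :=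
    integrandAddRel_subset_relations ⟨n, _, _, _, rfl, rfl, fun x _ ↦ by simp [zeroRep], rfl⟩
  rw [sub_self, zero_sub] at h
  simpa using relations.neg_mem h

/-- **Representations with the same domain and integrands agreeing on it are KZ-equivalent**
(integrand additivity against the zero representation). [cite: KontsevichZagier2001, §1.2 rule (1)] -/
theorem equivalent_of_eqOn (r r' : IntegralRep n) (hd : r'.domain = r.domain)
    (he : EqOn r.integrand r'.integrand r.domain) : Equivalent r r' := by
  have h1 : of r - of r' - of (zeroRep r.domain r.isSemialgebraic_domain) ∈ relations :=
    integrandAddRel_subset_relations ⟨n, r, r', zeroRep r.domain r.isSemialgebraic_domain, hd, rfl,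
      fun x hx ↦ by simp [zeroRep, he hx], rfl⟩
  have h2 := of_zeroRep_mem_relations r.domain r.isSemialgebraic_domain
  have := relations.add_mem h1 h2
  rwa [sub_add_cancel] at this

/-- **Representations with the same domain and opposite integrands on it sum to a relation.**
[cite: KontsevichZagier2001, §1.2 rule (1)] -/
theorem of_add_of_mem_relations_of_eqOn_neg (r r' : IntegralRep n) (hd : r'.domain = r.domain)
    (he : EqOn r'.integrand (-r.integrand) r.domain) : of r + of r' ∈ relations := by
  have h1 : of (zeroRep r.domain r.isSemialgebraic_domain) - of r - of r' ∈ relations :=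
    integrandAddRel_subset_relations ⟨n, zeroRep r.domain r.isSemialgebraic_domain, r, r', rfl, hd,
      fun x hx ↦ by simp [zeroRep, he hx], rfl⟩
  have h2 := of_zeroRep_mem_relations r.domain r.isSemialgebraic_domain
  have := relations.sub_mem h2 h1
  rw [show of (zeroRep r.domain r.isSemialgebraic_domain) -
      (of (zeroRep r.domain r.isSemialgebraic_domain) - of r - of r') = of r + of r' by abel] at this
  exact this

end KZHelpers

/-! ### The reflection `z ↦ -z̄`: conjugate symbols -/

/-- The reflection `τ ↦ -τ̄` of `ℍ` in the imaginary axis. [folklore] -/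
def negConjPt (τ : ℍ) : ℍ := ⟨-(starRingEnd ℂ) (τ : ℂ), by simpa using τ.im_pos⟩

/-- Underlying complex number of `negConjPt`. [folklore] -/
@[simp] theorem coe_negConjPt (τ : ℍ) : (negConjPt τ : ℂ) = -(starRingEnd ℂ) (τ : ℂ) := rfl

/-- The axis is fixed by the reflection. [folklore] -/
theorem negConjPt_axisPt {t : ℝ} (ht : 0 < t) : negConjPt (axisPt t) = axisPt t := by
  apply UpperHalfPlane.ext
  rw [coe_negConjPt, coe_axisPt ht]
  simp

/-- `q(-τ̄) = conj q(τ)` for the nome `q = e^{2πiτ}`. [folklore] -/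
theorem qParam_negConjPt (τ : ℍ) :
    Function.Periodic.qParam 1 (negConjPt τ : ℂ) = (starRingEnd ℂ) (Function.Periodic.qParam 1 (τ : ℂ)) := by
  rw [Function.Periodic.qParam, Function.Periodic.qParam, ← Complex.exp_conj, coe_negConjPt]
  congr 1
  simp only [map_div₀, map_mul, Complex.conj_ofReal, Complex.conj_I, map_ofNat]
  ring

/-- **A `q`-series with real coefficients satisfies `φ(-τ̄) = conj φ(τ)`.** [folklore] -/
theorem apply_negConjPt_of_hasSum {φ : ℍ → ℂ} {c : ℕ → ℂ}
    (hsum : ∀ τ : ℍ, HasSum (fun n ↦ c n * Function.Periodic.qParam 1 (τ : ℂ) ^ n) (φ τ))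
    (hc : ∀ n, (starRingEnd ℂ) (c n) = c n) (τ : ℍ) :
    φ (negConjPt τ) = (starRingEnd ℂ) (φ τ) := by
  have h1 := hsum (negConjPt τ)
  simp_rw [qParam_negConjPt] at h1
  have h2 : HasSum (fun n ↦ (starRingEnd ℂ) (c n * Function.Periodic.qParam 1 (τ : ℂ) ^ n))
      ((starRingEnd ℂ) (φ τ)) := Complex.hasSum_conj'.mpr (hsum τ)
  have h3 : (fun n ↦ (starRingEnd ℂ) (c n * Function.Periodic.qParam 1 (τ : ℂ) ^ n)) =
      fun n ↦ c n * (starRingEnd ℂ) (Function.Periodic.qParam 1 (τ : ℂ)) ^ n := by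
    funext n; rw [map_mul, map_pow, hc]
  rw [h3] at h2
  exact h1.unique h2

/-- A cusp form on `Γ₀(N)` with real Fourier coefficients satisfies `f(-τ̄) = conj f(τ)`
(Cremona §2.8, after (2.8.8)). [cite: CremonaAlgorithms1997, §2.8 (after (2.8.8))] -/
theorem apply_negConjPt [NeZero N] (f : CuspForm (Gamma0 N) 2)
    (hf : ∀ n, (starRingEnd ℂ) ((qExpansion 1 ⇑f).coeff n) = (qExpansion 1 ⇑f).coeff n) (τ : ℍ) :
    f (negConjPt τ) = (starRingEnd ℂ) (f τ) :=
  apply_negConjPt_of_hasSum (isCuspFunction_one f).hasSum hf τ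

/-- **The reflected matrix** `g^ε = ε g ε`, `ε = diag(-1, 1)`: `(a b; c d) ↦ (a -b; -c d)`. The arc
`g^ε·(iℝ_{>0})` is the mirror image `-conj(g·(iℝ_{>0}))` of the arc of `g`
(`reflect_smul_axisPt`). [cite: CremonaAlgorithms1997, §2.1 (z ↦ z* = -z̄, γ̃ = JγJ) and §2.8] -/
def reflect (g : SL(2, ℤ)) : SL(2, ℤ) :=
  ⟨!![g 0 0, -(g 0 1); -(g 1 0), g 1 1], by
    rw [Matrix.det_fin_two_of]
    have := Matrix.SpecialLinearGroup.det_coe g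
    rw [Matrix.det_fin_two] at this
    linarith⟩

/-- Entries of the reflected matrix. [folklore] -/
@[simp] theorem reflect_apply_00 (g : SL(2, ℤ)) : reflect g 0 0 = g 0 0 := rfl
/-- Entries of the reflected matrix. [folklore] -/
@[simp] theorem reflect_apply_01 (g : SL(2, ℤ)) : reflect g 0 1 = -(g 0 1) := rfl
/-- Entries of the reflected matrix. [folklore] -/
@[simp] theorem reflect_apply_10 (g : SL(2, ℤ)) : reflect g 1 0 = -(g 1 0) := rfl
/-- Entries of the reflected matrix. [folklore] -/
@[simp] theorem reflect_apply_11 (g : SL(2, ℤ)) : reflect g 1 1 = g 1 1 := rfl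

/-- `reflect` is an involution. [folklore] -/
@[simp] theorem reflect_reflect (g : SL(2, ℤ)) : reflect (reflect g) = g := by
  ext i j; fin_cases i <;> fin_cases j <;> simp [reflect]

/-- **`g^ε · (it) = -conj(g · it)`**: the reflected arc. [cite: CremonaAlgorithms1997, §2.1 (z ↦ z* = -z̄, γ̃ = JγJ) and §2.8] -/
theorem reflect_smul_axisPt (g : SL(2, ℤ)) {t : ℝ} (ht : 0 < t) :
    reflect g • axisPt t = negConjPt (g • axisPt t) := by
  apply UpperHalfPlane.ext
  rw [coe_negConjPt, UpperHalfPlane.coe_specialLinearGroup_apply,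
    UpperHalfPlane.coe_specialLinearGroup_apply, coe_axisPt ht]
  have hden : ((algebraMap ℤ ℝ (g 1 0) : ℝ) : ℂ) * ((t : ℂ) * I) + ((algebraMap ℤ ℝ (g 1 1) : ℝ) : ℂ) ≠ 0 := by
    rw [← coe_axisPt ht]
    exact UpperHalfPlane.denom_ne_zero (g : GL (Fin 2) ℝ) (axisPt t)
  have hden' : (starRingEnd ℂ) (((algebraMap ℤ ℝ (g 1 0) : ℝ) : ℂ) * ((t : ℂ) * I) +
      ((algebraMap ℤ ℝ (g 1 1) : ℝ) : ℂ)) ≠ 0 :=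
    (map_ne_zero_iff _ (RingHom.injective _)).mpr hden
  simp only [reflect_apply_00, reflect_apply_01, reflect_apply_10, reflect_apply_11, map_neg,
    Complex.ofReal_neg, map_div₀, map_add, map_mul, Complex.conj_ofReal, Complex.conj_I]
  simp only [map_add, map_mul, Complex.conj_ofReal, Complex.conj_I] at hden'
  field_simp
  ring

/-- **`(f ∣ g^ε)(it) = conj ((f ∣ g)(it))`** for `f` with real Fourier coefficients.
[cite: CremonaAlgorithms1997, §2.1 (z ↦ z* = -z̄, γ̃ = JγJ) and §2.8] -/
theorem slash_reflect_axisPt [NeZero N] (f : CuspForm (Gamma0 N) 2)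
    (hf : ∀ n, (starRingEnd ℂ) ((qExpansion 1 ⇑f).coeff n) = (qExpansion 1 ⇑f).coeff n)
    (g : SL(2, ℤ)) {t : ℝ} (ht : 0 < t) :
    (⇑f ∣[(2 : ℤ)] reflect g) (axisPt t) = (starRingEnd ℂ) ((⇑f ∣[(2 : ℤ)] g) (axisPt t)) := by
  rw [ModularForm.SL_slash_apply, ModularForm.SL_slash_apply, reflect_smul_axisPt g ht,
    apply_negConjPt f hf, map_mul, ModularGroup.denom_apply, ModularGroup.denom_apply, coe_axisPt ht]
  congr 1
  rw [map_zpow₀]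
  congr 1
  simp only [reflect_apply_10, reflect_apply_11, Int.cast_neg, map_add, map_mul, Complex.conj_ofReal,
    Complex.conj_I, map_intCast]
  ring

/-- On the axis the quotient `2πi φ/j'` is a REAL multiple of `φ`: for `t > 1`,
`djQuot φ (it) = (-2π / axisJDeriv t) · φ(it)`. [folklore] -/
theorem djQuot_axisPt {t : ℝ} (ht : 1 < t) (φ : ℍ → ℂ) :
    djQuot φ (axisPt t) = ((-(2 * Real.pi) / axisJDeriv t : ℝ) : ℂ) * φ (axisPt t) := by
  have h := abs_axisJDeriv_smul_djQuot ht φ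
  rw [abs_of_pos (axisJDeriv_pos ht), Complex.real_smul] at h
  have hD : ((axisJDeriv t : ℝ) : ℂ) ≠ 0 := Complex.ofReal_ne_zero.mpr (axisJDeriv_ne_zero ht)
  have h' : djQuot φ (axisPt t) = -(2 * Real.pi) * φ (axisPt t) / (axisJDeriv t : ℂ) := by
    rw [eq_div_iff hD, mul_comm]; exact h
  rw [h']
  push_cast
  ring

/-- **Conjugate symbols have conjugate canonical integrands**: for `f` with real Fourier
coefficients, `arcIntegrand (f ∣ g^ε) u = conj (arcIntegrand (f ∣ g) u)` on `u > 1728`. In the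
algebraic coordinate the real involution `z ↦ -z̄` of `X₀(N)` is `(u, w) ↦ (u, w̄)`.
[cite: CremonaAlgorithms1997, §2.1 (z ↦ z* = -z̄, γ̃ = JγJ) and §2.8] -/
theorem arcIntegrand_reflect [NeZero N] (f : CuspForm (Gamma0 N) 2)
    (hf : ∀ n, (starRingEnd ℂ) ((qExpansion 1 ⇑f).coeff n) = (qExpansion 1 ⇑f).coeff n)
    (g : SL(2, ℤ)) {u : ℝ} (hu : 1728 < u) :
    arcIntegrand (⇑f ∣[(2 : ℤ)] reflect g) u = (starRingEnd ℂ) (arcIntegrand (⇑f ∣[(2 : ℤ)] g) u) := by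
  have ht := one_lt_axisParam hu
  rw [arcIntegrand, arcIntegrand, djQuot_axisPt ht, djQuot_axisPt ht,
    slash_reflect_axisPt f hf g (one_pos.trans ht), map_mul, Complex.conj_ofReal]

/-- Real parts of conjugate symbols agree on the domain. [cite: CremonaAlgorithms1997, §2.1 (z ↦ z* = -z̄, γ̃ = JγJ) and §2.8] -/
theorem eqOn_arcIntegrand_reflect_re [NeZero N] (f : CuspForm (Gamma0 N) 2)
    (hf : ∀ n, (starRingEnd ℂ) ((qExpansion 1 ⇑f).coeff n) = (qExpansion 1 ⇑f).coeff n) (g : SL(2, ℤ)) :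
    EqOn (fun x : Fin 1 → ℝ ↦ (arcIntegrand (⇑f ∣[(2 : ℤ)] g) (x 0)).re)
      (fun x ↦ (arcIntegrand (⇑f ∣[(2 : ℤ)] reflect g) (x 0)).re) arcDomain := by
  intro x hx
  simp only
  rw [arcIntegrand_reflect f hf g hx, Complex.conj_re]

/-- Imaginary parts of conjugate symbols are opposite on the domain. [cite: CremonaAlgorithms1997, §2.1 (z ↦ z* = -z̄, γ̃ = JγJ) and §2.8] -/
theorem eqOn_arcIntegrand_reflect_im [NeZero N] (f : CuspForm (Gamma0 N) 2)
    (hf : ∀ n, (starRingEnd ℂ) ((qExpansion 1 ⇑f).coeff n) = (qExpansion 1 ⇑f).coeff n) (g : SL(2, ℤ)) :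
    EqOn (fun x : Fin 1 → ℝ ↦ (arcIntegrand (⇑f ∣[(2 : ℤ)] reflect g) (x 0)).im)
      (-fun x ↦ (arcIntegrand (⇑f ∣[(2 : ℤ)] g) (x 0)).im) arcDomain := by
  intro x hx
  simp only [Pi.neg_apply]
  rw [arcIntegrand_reflect f hf g hx, Complex.conj_im]

/-- **Admissibility is preserved by the reflection.** [cite: CremonaAlgorithms1997, §2.1 (z ↦ z* = -z̄, γ̃ = JγJ) and §2.8] -/
theorem HalfArcAdmissible.reflect [NeZero N] {f : CuspForm (Gamma0 N) 2}
    (hf : ∀ n, (starRingEnd ℂ) ((qExpansion 1 ⇑f).coeff n) = (qExpansion 1 ⇑f).coeff n) {g : SL(2, ℤ)}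
    (h : HalfArcAdmissible (⇑f ∣[(2 : ℤ)] g)) : HalfArcAdmissible (⇑f ∣[(2 : ℤ)] reflect g) where
  isSemialgebraicFunOn_re := h.isSemialgebraicFunOn_re.congr (eqOn_arcIntegrand_reflect_re f hf g)
  isSemialgebraicFunOn_im :=
    h.isSemialgebraicFunOn_im.neg.congr (eqOn_arcIntegrand_reflect_im f hf g).symm
  integrableOn := (isCuspFunction_slash f (_root_.Literature.NumberTheory.EllipticCurves.ModularForms.reflect g)).integrableOn_arcIntegrand

/-- `(gS)^ε = -(g^ε S)`. [folklore] -/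
theorem reflect_mul_S (g : SL(2, ℤ)) :
    reflect (g * ModularGroup.S) = -(reflect g * ModularGroup.S) := by
  ext i j
  fin_cases i <;> fin_cases j <;>
    simp [reflect, Matrix.SpecialLinearGroup.coe_mul, ModularGroup.coe_S, Matrix.mul_apply,
      Fin.sum_univ_two]

/-- `f ∣ (gS)^ε = f ∣ (g^ε S)` in weight `2`. [folklore] -/
theorem slash_reflect_mul_S (φ : ℍ → ℂ) (g : SL(2, ℤ)) :
    φ ∣[(2 : ℤ)] reflect (g * ModularGroup.S) = φ ∣[(2 : ℤ)] (reflect g * ModularGroup.S) := by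
  rw [reflect_mul_S, slash_two_neg]

namespace ModularSymbolRep

variable [NeZero N] {f : CuspForm (Gamma0 N) 2} {g : SL(2, ℤ)}

/-- **Admissibility of the conjugate symbol** `⟨g^ε⟩_f` from that of `⟨g⟩_f`, for `f` with real
Fourier coefficients. [cite: CremonaAlgorithms1997, §2.1 (z ↦ z* = -z̄, γ̃ = JγJ) and §2.8] -/
theorem reflect (hf : ∀ n, (starRingEnd ℂ) ((qExpansion 1 ⇑f).coeff n) = (qExpansion 1 ⇑f).coeff n)
    (ρ : ModularSymbolRep f g) :
    ModularSymbolRep f (_root_.Literature.NumberTheory.EllipticCurves.ModularForms.reflect g) where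
  upper := ρ.upper.reflect hf
  lower := slash_reflect_mul_S (⇑f) g ▸ ρ.lower.reflect hf

/-- **Conjugate symbols, real parts: `[re ⟨g^ε⟩_f] ≡ [re ⟨g⟩_f]` modulo the KZ moves** (indeed by
integrand additivity alone: the integrands agree on the domain). [cite: CremonaAlgorithms1997, §2.1 (z ↦ z* = -z̄, γ̃ = JγJ) and §2.8] -/
theorem classRe_reflect_sub_mem_relations
    (hf : ∀ n, (starRingEnd ℂ) ((qExpansion 1 ⇑f).coeff n) = (qExpansion 1 ⇑f).coeff n)
    (ρ : ModularSymbolRep f g)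
    (ρ' : ModularSymbolRep f (_root_.Literature.NumberTheory.EllipticCurves.ModularForms.reflect g)) :
    ρ'.classRe - ρ.classRe ∈ Literature.NumberTheory.Transcendental.KZ.relations := by
  have h1 : Literature.NumberTheory.Transcendental.KZ.Equivalent
      (halfArcRepRe _ ρ'.upper) (halfArcRepRe _ ρ.upper) :=
    equivalent_of_eqOn _ _ rfl (eqOn_arcIntegrand_reflect_re f hf g).symm
  have h2 : Literature.NumberTheory.Transcendental.KZ.Equivalent
      (halfArcRepRe _ ρ'.lower) (halfArcRepRe _ ρ.lower) := by
    refine equivalent_of_eqOn _ _ rfl ?_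
    have := (eqOn_arcIntegrand_reflect_re f hf (g * ModularGroup.S)).symm
    rwa [slash_reflect_mul_S] at this
  have := Literature.NumberTheory.Transcendental.KZ.relations.sub_mem h1 h2
  simp only [classRe]
  convert this using 1
  abel

/-- **Conjugate symbols, imaginary parts: `[im ⟨g^ε⟩_f] + [im ⟨g⟩_f] ≡ 0` modulo the KZ moves**
(the integrands are opposite on the domain). [cite: CremonaAlgorithms1997, §2.1 (z ↦ z* = -z̄, γ̃ = JγJ) and §2.8] -/
theorem classIm_reflect_add_mem_relations
    (hf : ∀ n, (starRingEnd ℂ) ((qExpansion 1 ⇑f).coeff n) = (qExpansion 1 ⇑f).coeff n)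
    (ρ : ModularSymbolRep f g)
    (ρ' : ModularSymbolRep f (_root_.Literature.NumberTheory.EllipticCurves.ModularForms.reflect g)) :
    ρ'.classIm + ρ.classIm ∈ Literature.NumberTheory.Transcendental.KZ.relations := by
  have h1 : Literature.NumberTheory.Transcendental.KZ.of (halfArcRepIm _ ρ.upper) +
      Literature.NumberTheory.Transcendental.KZ.of (halfArcRepIm _ ρ'.upper) ∈
        Literature.NumberTheory.Transcendental.KZ.relations :=
    of_add_of_mem_relations_of_eqOn_neg _ _ rfl (eqOn_arcIntegrand_reflect_im f hf g)
  have h2 : Literature.NumberTheory.Transcendental.KZ.of (halfArcRepIm _ ρ.lower) +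
      Literature.NumberTheory.Transcendental.KZ.of (halfArcRepIm _ ρ'.lower) ∈
        Literature.NumberTheory.Transcendental.KZ.relations := by
    refine of_add_of_mem_relations_of_eqOn_neg _ _ rfl ?_
    have := eqOn_arcIntegrand_reflect_im f hf (g * ModularGroup.S)
    rwa [slash_reflect_mul_S] at this
  have := Literature.NumberTheory.Transcendental.KZ.relations.sub_mem h1 h2
  simp only [classIm]
  convert this using 1
  abel

end ModularSymbolRep

/-! ### Existence for rational newforms (the one arithmetic–geometric input, a named fact) -/

/-- A cusp form has **rational Fourier coefficients** if every coefficient of its `q`-expansion at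
`∞` is the image of a rational number (Cremona's "rational newforms", §2.6; e.g. the newform of an
elliptic curve over `ℚ`). [cite: CremonaAlgorithms1997, §2.6] -/
def HasRatCoeffs (f : CuspForm (Gamma0 N) 2) : Prop :=
  ∀ n, (qExpansion 1 ⇑f).coeff n ∈ Set.range ((↑) : ℚ → ℂ)

/-- Rational coefficients are real: fixed by complex conjugation (the hypothesis of the reflection
lemmas `apply_negConjPt`, `arcIntegrand_reflect`, `ModularSymbolRep.reflect`). [folklore] -/
theorem HasRatCoeffs.conj_coeff {f : CuspForm (Gamma0 N) 2} (hf : HasRatCoeffs f) (n : ℕ) :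
    (starRingEnd ℂ) ((qExpansion 1 ⇑f).coeff n) = (qExpansion 1 ⇑f).coeff n := by
  obtain ⟨r, hr⟩ := hf n
  rw [← hr, Complex.conj_eq_iff_real]  -- a rational number is real
  exact ⟨r, by simp⟩

/-- **Modular symbols of rational cusp forms admit the canonical Kontsevich–Zagier representation
(semialgebraicity of the canonical integrand).**  For `f ∈ S₂(Γ₀(N))` with rational Fourier
coefficients and `g ∈ SL₂(ℤ)`, the real and imaginary parts of the canonical integrand
`w(u) = arcIntegrand (f ∣ g) u = (ω_f/dj)(g · i t₊(u))` are `ℚ`-semialgebraic functions on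
`(1728, ∞)`.  This is the modular-curve instance of the principle by which Kontsevich–Zagier write
integrals of modular forms defined over `ℚ` as periods — reparametrise by a modular function defined
over `ℚ` (§2.3 Facts 1–2, §3.4 "use it to reparametrize our modular curve") — and is the
conjunction of three printed results, recorded here as ONE named fact because the tree has neither
the field `𝔉_N` nor cylindrical decomposition:
(i) ALGEBRAICITY OVER `ℚ(j)`: `F₀ = fΔ/(E₄²E₆)` is a modular function of level `N` with rational
Fourier coefficients, hence lies in the field `𝔉_N` of modular functions of level `N` whose Fourier
coefficients lie in `ℚ(e^{2πi/N})` (Shimura 1971, Prop. 6.9 (1)); `𝔉_N` is a finite Galois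
extension of `ℚ(j)` on which `h ↦ h ∘ γ`, `γ ∈ SL₂(ℤ)`, acts by automorphisms (`f_a ↦ f_{aγ}`,
Thm. 6.6 (1), (2)), so `F₀ ∘ g = (f ∣ g)Δ/(E₄²E₆) = djQuot (f ∣ g) ∈ 𝔉_N` and there is an irreducible
`P ∈ ℚ[U, V]` of positive `V`-degree (the minimal polynomial of `F₀ ∘ g` over `ℚ(j)`, denominators
cleared) with `P(j, F₀ ∘ g) = 0` on `ℍ`; as `j(i t₊(u)) = u` (`kleinJ_axisPt_axisParam`),
`P(u, w(u)) = 0` for `u > 1728`, i.e. the graph of `(re w, im w)` lies in the `ℚ`-algebraic subset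
`Z = {P(u, a + ib) = 0}` of `ℝ³`, whose fibres over every real `u` are finite (`P(u, ·) ≢ 0`:
an irreducible `P` involving `V` is not divisible by the minimal polynomial of an algebraic `u`);
(ii) CONTINUITY: `w` is continuous on `(1728, ∞)` (`continuousOn_arcIntegrand`, proved here);
(iii) SEMIALGEBRAIC BRANCHES: a cylindrical decomposition of `ℝ³` adapted to `{re P, im P}`
(Basu–Pollack–Roy, Thm. 5.6 with Def. 5.1 and Prop. 5.3; cells described over the ring `ℚ` of
coefficients, Thm. 2.76–2.77) partitions `(1728, ∞)` into finitely many points and open intervals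
over each of which `Z` is a finite disjoint union of graphs of continuous `ℚ`-semialgebraic maps
(1-cells; no bands, the fibres being finite); on each interval the connected graph of the
continuous `w` is one of these 1-cells, and over each partition point it is a 0-cell, so the graph
of `(re w, im w)` over `(1728, ∞)` is a finite union of cells, `ℚ`-semialgebraic, and so are its
two coordinate projections to `ℝ²` (Thm. 2.76).
[cite: Shimura1971, §6.2 Thm. 6.6 (1)–(2) and Prop. 6.9 (1); BasuPollackRoy2006, Thm. 5.6, Def. 5.1, Prop. 5.3, Thm. 2.76–2.77; KontsevichZagier2001, §3.4] -/
def isSemialgebraicFunOn_arcIntegrand_slash : Prop :=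
  ∀ {N : ℕ} [NeZero N] (f : CuspForm (Gamma0 N) 2), HasRatCoeffs f → ∀ g : SL(2, ℤ),
    IsSemialgebraicFunOn ℚ arcDomain (fun x ↦ (arcIntegrand (⇑f ∣[(2 : ℤ)] g) (x 0)).re) ∧
      IsSemialgebraicFunOn ℚ arcDomain (fun x ↦ (arcIntegrand (⇑f ∣[(2 : ℤ)] g) (x 0)).im)

/-- **Existence of the canonical representation for rational cusp forms**, from the named fact
`isSemialgebraicFunOn_arcIntegrand_slash` (semialgebraicity) and the proved integrability of the
canonical integrand of the cusp functions `f ∣ g`, `f ∣ gS` (`HalfArcAdmissible.of_isCuspFunction`,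
`isCuspFunction_slash`). [cite: KontsevichZagier2001, §3.4] -/
theorem ModularSymbolRep.of_hasRatCoeffs [NeZero N] (H : isSemialgebraicFunOn_arcIntegrand_slash)
    (f : CuspForm (Gamma0 N) 2) (hf : HasRatCoeffs f) (g : SL(2, ℤ)) : ModularSymbolRep f g where
  upper := HalfArcAdmissible.of_isCuspFunction (isCuspFunction_slash f g) (H f hf g).1 (H f hf g).2
  lower := HalfArcAdmissible.of_isCuspFunction (isCuspFunction_slash f (g * ModularGroup.S))
    (H f hf (g * ModularGroup.S)).1 (H f hf (g * ModularGroup.S)).2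

/-- Under the named fact, **every modular symbol `⟨g⟩_f` of a rational cusp form is a
Kontsevich–Zagier period with the canonical representation**: `re ⟨g⟩_f = KZ.eval ρ.classRe`,
`im ⟨g⟩_f = KZ.eval ρ.classIm` for `ρ = ModularSymbolRep.of_hasRatCoeffs H f hf g`.
[cite: KontsevichZagier2001, §3.4] -/
theorem eval_classRe_of_hasRatCoeffs [NeZero N] (H : isSemialgebraicFunOn_arcIntegrand_slash)
    (f : CuspForm (Gamma0 N) 2) (hf : HasRatCoeffs f) (g : SL(2, ℤ)) :
    Literature.NumberTheory.Transcendental.KZ.eval (ModularSymbolRep.of_hasRatCoeffs H f hf g).classRe =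
      (unimodularSymbol f g).re :=
  (ModularSymbolRep.of_hasRatCoeffs H f hf g).eval_classRe

end Literature.NumberTheory.EllipticCurves.ModularForms

end
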